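import Mathlib
import HarnessLib
import Literature.Probability.LatticeModels.LatticeGreenFunction
import Literature.Probability.LatticeModels.MaxwellKernelBand
import Summits.QuantumFields.YangMills.Theses.LangevinControlUV
import Summits.QuantumFields.YangMills.Theorems.LangevinControlUVFemtoCurvatureTwoPointOffAxisDomination
import Summits.QuantumFields.YangMills.Theorems.LangevinControlUVFemtoCurvatureTwoPointDiagFamilies
-- (temporarily disabled until the farm snapshot has the module) import Summits.QuantumFields.YangMills.Theorems.LangevinControlUVFemtoCurvatureTwoPointStubWickSquares
-- (temporarily disabled until the farm snapshot has the module) import Summits.QuantumFields.YangMills.Theorems.LangevinControlUVFemtoCurvatureTwoPointStubFieldStrengthCovariance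
import Summits.QuantumFields.YangMills.Theorems.FemtoCurvatureTwoPoint.Negative.PlaquetteFreezing
import Summits.QuantumFields.YangMills.Theorems.FemtoCurvatureTwoPoint.Negative.ForcedDividend
import Summits.QuantumFields.YangMills.Theorems.FemtoCurvatureTwoPoint.Negative.UpperOnly
import Literature.Barriers.CriticalPhenomena.PositionSpaceRGNonGibbsianChessboard

/-!
# Line `generic-step-gamma-encoding` — skeleton for crux `FemtoCurvatureTwoPoint`
# (stmt-QuantumFields-9363, route LangevinControlUV)

Crux-plan of idea card `Cruxes/FemtoCurvatureTwoPoint/Ideas/generic-step-gamma-encoding.md`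
(ideator 1, triage r1: pass ×3).

**The line.** The crux quantifies `∃ a, ∃ Γ β₀ ℓ₀ c C, …` with the shape `Γ` constrained only
pointwise (`0 < Γ ≤ 1` on `(0, ℓ₀]`). A STEP unit map `a(β) = α_k` on `β ∈ [2^k, 2^{k+1})` with
GENERIC values `α_k` makes every argument `s = dist · a(β)` at which the crux evaluates `Γ`
(`dist = √m`, `m ≥ 1`) come from exactly one step `k`, so `Γ(√m · α_k) := 4^{-k}` (else `1`) is a
legitimate shape, and `2^k ≤ β < 2^{k+1}` turns two-sided FIXED-TORUS bounds `[c, C] · β⁻²` into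
`[(c/4) Γ, |C| Γ]`. The values `α_k := (1 + t 2^{-k}) / (L_k + 1)` (generic `t ∈ [1/2, 1]`) are tied
to a threshold ladder `L_k := max {L : T(L) ≤ 2^k}` (`T` a monotone envelope of the per-torus
thresholds), so that a femto torus `L · a(β) ≤ 1` in step `k` is exactly a VALIDATED torus
`L ≤ L_k`, and `a → 0` because `L_k → ∞`. Hence the crux AS TYPED follows from
`FixedTorusTwoSided` (= the card's C⁺ `FixedTorusSemiclassicalTwoPoint`, in the sharpened threshold
form asked for by TRIAGE r1-1 (A)/(B) and r1-3): on EVERY torus `(ℤ/L)⁴`, for `β ≥ B(L)` (an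
arbitrary, `L`-dependent threshold), `c ≤ β² n⁸ Cov(P_0^{01}, P_{ne₂}^{01}) ≤ C` for `8 ≤ 8n ≤ L` and
`β² |Cov(P_x^{ij}, P_y^{i'j'})| dist⁸ ≤ C` for `x ≠ y`, with `c, C` uniform in `L`. This transfer
(`encoding`, the card's `crux_of_encoding`) is PROVED below, sorry-free; it is the composition.

**Stubs (registered; the only `sorry`s in this file). Lead -0 reshape 2026-08-16T05:11Z: every
signature SELF-CONTAINED (Mathlib/Literature names only). Lead c1 reshape 2026-08-16T12:45Z: the
all-pairs Gaussian-domination stub GD⁺ (`stub_pairGaussianUpper`, blocked: needs chart + second-order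
Laplace asymptotics, stub-worker verdict) and its kernel input K1b (`stub_greenHessianDecay`, LANDED
p92455, no longer needed by the composition) are replaced by OA + DU below.**
* `stub_maxwellKernelBand` — K1a, LANDED (p94229): `c ≤ n⁴ K_L(ne₂) ≤ C`, `8n ≤ L`, uniformly in `L`.
* GD⁻ (`AxisGaussianLower`, HARDEST, crux-sized) — lead c2 reshape 2026-08-16T15:40Z: FACTORED as
  `axisGaussianLower_of_domination stub_wickSquares stub_fieldStrengthCovariance
  stub_axisGaussianDomination` (glue PROVED):
  - `stub_wickSquares` — W (provable now, Mathlib `multivariateGaussian`): Isserlis/Wick covariance of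
    squares of two linear functionals of a centred Gaussian vector, `Cov(X², Y²) = 2 Cov(X, Y)²`;
  - `stub_fieldStrengthCovariance` — F (provable now, torus Fourier sums): the Feynman-gauge lattice
    Maxwell covariance `S_L((x,μ),(y,ν)) = δ_{μν} G_L(x−y)` (`G_L = torusGreen`) is positive
    semidefinite and its field-strength two-point function is `⟨F₀₁(x) F₀₁(y)⟩ = 2 K_L(x−y)` with
    `K_L` the K1a kernel;
  - `stub_axisGaussianDomination` — GD-dom (the crux-sized core, unchanged in size by the reshape):
    on a fixed torus, eventually in `β`, `β² Cov_{L,β}(P_0^{01}, P_{ne₂}^{01})` dominates `κ ×` the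
    covariance of the SAME two squared field strengths under the reference Gaussian
    `multivariateGaussian 0 S_L` ("Gaussian domination from below"; second-order Laplace asymptotics
    of Wilson's measure near the singular flat variety; not in print for non-abelian `G`).
  The reshape moves the reference-Gaussian computation (Wick square `2(2K)² = 8K²`) out of the core
  stub into two provable stubs consumed by checked glue; it does not shrink the core.
* `stub_offAxisDomination` — OA (NEW, c1): reflection-positivity Cauchy–Schwarz ⇒ every plaquette pair
  is dominated by the two DIAGONAL families along any separating direction (β-uniform, every compact
  `G`; provable now from the landed RP helpers `…MirrorPairs`, `…AxisCovNonneg`,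
  `…PlaqReflectCauchySchwarz`).
* DU₂ (`DiagUpperTwoProfiles`; c1; second reshape 13:40Z to TWO PROFILES): the XL residue of K2⁺ —
  fixed-torus `β⁻²` upper bounds for the transverse profile `Cov(P_0^{01}, P_{se₂}^{01})` (the crux's
  axis family), the longitudinal profile `Cov(P_0^{01}, P_{se₀}^{01})` (`· min(s,L−s)⁸ ≤ C`) and
  `β² Var P_0^{01} ≤ C`; the 24 diagonal families reduce to these by the LANDED hypercubic reduction
  `Theorems.FemtoCurvatureTwoPoint.diagFamilies_two_profiles` (glue `diagUpper_of_twoProfiles`).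
  Lead c2 second reshape 2026-08-16T18:30Z: DU₂ is FACTORED as `diagUpperTwoProfiles_of_parts VAR REST`
  (glue proved) — VAR = the variance clause on DYADIC tori, delivered by a reflection-positivity route
  (`stub_plaquetteProductRPCS` ⇒ `stub_chessboard_of_RPCS` ⇒ `stub_variance_of_chessboard_doubling`,
  with the doubling `stub_doubling_of_RV` of `Z_L` from the NAMED FACT `stub_wilsonPartitionRV`,
  Watanabe 2009 Thm 7.1 / AGV II Thm 7.6), REST = `stub_diagUpperRest` (variance on non-dyadic tori + the
  two profiles; crux-sized core).

**Composition.** `FemtoCurvatureTwoPoint_of : LangevinControlUV.FemtoCurvatureTwoPoint` (applies the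
`stub_*` theorems: `axisLower_of` K1a (GD⁻ := `axisGaussianLower_of_domination` W F GD-dom) : K2⁻ and
`pairUpper_of'` OA DU : K2⁺) — real proof, the ONLY
theorem of the file concluding the crux by name: `fixedTorusTwoSided_of` (merge thresholds, axis upper
bound from the pair bound at `dist(0, ne₂) = n`) then `encoding_at` (the generic-step encoding at
fixed `(G, r)`, sorry-free); `encoding : FixedTorusTwoSided → ∀ G r, CruxAt r` and
`cruxAt_of_deepBand : DeepBandTwoPoint → ∀ G r, CruxAt r` are its corollaries in the unbundled
form (`femtoCurvatureTwoPoint_iff_cruxAt : crux ↔ ∀ G r, CruxAt r` is `Iff.rfl`).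

**Disproof used** (`Cruxes/FemtoCurvatureTwoPoint/Disproof.lean`, cdisprove gen 1 v3; landed
extracts imported above and elaborated with this file): no `_false_without_` theorem exists for
this crux; the stub set honours `§ UpperOnly` / `Negative.UpperOnly.exists_upperOnly` (the lower
bound is the unique content — it is isolated as `stub_axisLower`, rank "hardest"),
`§ LoadBearing` / `Negative.UnfaithfulFalse` (faithfulness: both analytic stubs are stated over
`r : LatticeRep G`, never a bare `ρ`), `§ Resists 3` / `Negative.FiniteGroup*` (connectedness: both
analytic stubs assume `IsCompactSimpleLieGroup G`; for finite `G` `stub_axisLower` would be FALSE,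
`Cov ≍ e^{-cβ}`), `Negative.ForcedDividend.no_shape_floor` (the encoded `Γ` has levels
`4^{-k} → 0`, no floor), `Negative.PlaquetteFreezing` (consistent: `β² Cov` bounded ⇒ `Cov → 0`),
and `§ Dissection` (`FixedTorusTwoSided ⇒ ESFB` with `K = |C|/c`; this file supplies the converse
"encoding direction" the Disproof leaves to provers).

Honesty (card item (5), all three triage notes): this line closes 9363 AS TYPED through the
`∃ a` / free-`Γ` loophole; its unit map decays as slowly as the thresholds dictate (`a ≫ a_AF`), so
the `∀ a`-items 9365–9367 inherit nothing from this witness. The repair `MonotoneOn Γ (Ioc 0 ℓ₀)`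
(or `Continuous a`) kills `encoding` (levels `4^{-k}` decrease along increasing arguments); K1/K2±
survive any repair as the `β → ∞` boundary layer of the honest statement.
-/

noncomputable section

open scoped BigOperators Matrix
open MeasureTheory Filter Topology ProbabilityTheory

namespace Summit.QuantumFields.YangMills.Cruxes.FemtoCurvatureTwoPoint.GenericStepGammaEncoding

open Literature.MathematicalPhysics.QuantumFieldTheory
open Literature.Barriers.CriticalPhenomena.NonGibbs (symP symM)

/-! ## § Statements -/

/-- **K1a — lattice Maxwell kernel band** (readable copy of the statement of `stub_maxwellKernelBand`;
identical, character for character up to layout, to `stub_maxwellKernelBand` of line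
`deep-band-gaussian-regime`). -/
def MaxwellKernelBand : Prop :=
  ∃ (c C : ℝ), 0 < c ∧ ∀ (L : ℕ) [NeZero L] (e₀ e₁ : Fin 4 → ZMod L) (K : (Fin 4 → ZMod L) → ℝ),
      e₀ = Pi.single (0 : Fin 4) (1 : ZMod L) → e₁ = Pi.single (1 : Fin 4) (1 : ZMod L) →
      (K = fun z =>
        ((2 * Literature.Probability.LatticeModels.torusGreen z
            - Literature.Probability.LatticeModels.torusGreen (z + e₀)
            - Literature.Probability.LatticeModels.torusGreen (z - e₀))
          + (2 * Literature.Probability.LatticeModels.torusGreen z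
            - Literature.Probability.LatticeModels.torusGreen (z + e₁)
            - Literature.Probability.LatticeModels.torusGreen (z - e₁))) / 2) →
      ∀ (n : ℕ), 1 ≤ n → 8 * n ≤ L →
        c ≤ (n : ℝ) ^ 4 * K (Pi.single (2 : Fin 4) ((n : ℕ) : ZMod L)) ∧
          (n : ℝ) ^ 4 * K (Pi.single (2 : Fin 4) ((n : ℕ) : ZMod L)) ≤ C

/-- **K2⁻ — fixed-torus axis LOWER bound, `L`-uniform constant** (readable copy of the conclusion of
`stub_axisLower`). For every compact simple `G` (any Borel structure) and faithful unitary `r` there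
are per-torus thresholds `B(L)` and ONE `c > 0` such that on every torus `(ℤ/L)⁴`, for `β ≥ B(L)`:
`c ≤ β² · n⁸ · Cov_{L,β}(P_0^{01}, P_{ne₂}^{01})` for `1 ≤ n`, `8n ≤ L`
(`P`, `E` enter through defining equations). -/
def AxisLowerFixedTorus : Prop :=
  ∀ (G : Type) [Group G] [TopologicalSpace G] [IsTopologicalGroup G] [CompactSpace G]
      [MeasurableSpace G] [BorelSpace G], IsCompactSimpleLieGroup G →
    ∀ (r : LatticeRep G), ∃ (B : ℕ → ℝ) (c : ℝ), 0 < c ∧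
      ∀ (L : ℕ) [NeZero L] (β : ℝ), B L ≤ β →
      ∀ (P : (Fin 4 → ZMod L) → Fin 4 → Fin 4 → GaugeConfig 4 L G → ℝ)
        (E : (GaugeConfig 4 L G → ℝ) → ℝ),
        (P = fun x i j U => (r.N : ℝ) - (r.ρ (plaquetteHolonomy U x i j)).trace.re) →
        (E = fun F => wilsonExpectation r.ρ β F) →
      ∀ (n : ℕ), 1 ≤ n → 8 * n ≤ L →
        c ≤ β ^ 2 * ((n : ℝ) ^ 8 *
          (E (fun U => P 0 0 1 U * P (Pi.single (2 : Fin 4) ((n : ℕ) : ZMod L)) 0 1 U) -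
            E (P 0 0 1) * E (P (Pi.single (2 : Fin 4) ((n : ℕ) : ZMod L)) 0 1)))

/-- **K2⁺ — fixed-torus all-pairs UPPER bound, `L`-uniform constant** (readable copy of the
conclusion of `stub_pairUpper`), on EVERY torus `L ≥ 1` including `L < 8`. -/
def PairUpperFixedTorus : Prop :=
  ∀ (G : Type) [Group G] [TopologicalSpace G] [IsTopologicalGroup G] [CompactSpace G]
      [MeasurableSpace G] [BorelSpace G], IsCompactSimpleLieGroup G →
    ∀ (r : LatticeRep G), ∃ (B : ℕ → ℝ) (C : ℝ),
      ∀ (L : ℕ) [NeZero L] (β : ℝ), B L ≤ β →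
      ∀ (P : (Fin 4 → ZMod L) → Fin 4 → Fin 4 → GaugeConfig 4 L G → ℝ)
        (E : (GaugeConfig 4 L G → ℝ) → ℝ),
        (P = fun x i j U => (r.N : ℝ) - (r.ρ (plaquetteHolonomy U x i j)).trace.re) →
        (E = fun F => wilsonExpectation r.ρ β F) →
      ∀ (x y : Fin 4 → ZMod L) (i j i' j' : Fin 4), x ≠ y → i ≠ j → i' ≠ j' →
        β ^ 2 * (|E (fun U => P x i j U * P y i' j' U) - E (P x i j) * E (P y i' j')|
          * Real.sqrt (∑ k : Fin 4, (((x k - y k).valMinAbs : ℤ) : ℝ) ^ 2) ^ 8) ≤ C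

/-- **GD⁻ — fixed-torus Gaussian domination from BELOW on the axis** (until reshape c2 the statement of
the stub `stub_axisGaussianLower`; since c2 the glued consequence `axisGaussianLower_of_stubs` of W, F,
GD-dom; the crux-sized residue of K2⁻). For every compact simple `G` and faithful
unitary `r` there is ONE `κ > 0` and per-torus thresholds `B(L)` such that for `β ≥ B(L)`,
`1 ≤ n ≤ L/8`: `κ · K_L(n e₂)² ≤ β² · Cov_{L,β}(P_0^{01}, P_{ne₂}^{01})`, `K_L` the tree-level
plaquette kernel of K1a. Content: second-order Laplace asymptotics of Wilson's measure on `G^E` near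
the (non-Morse–Bott) flat-connection variety — leading Gaussian term `(dim G/2)·⟨K_{L,θ}(ne₂)²⟩_θ β⁻²`
(law of total covariance over the flat background `θ`; the toron part `Var_θ E[P|θ] ≥ 0` adds
positively on the axis; twisted kernels within `O(L⁻⁴)` of `K_L`). Not in print for any non-abelian
`G` (fixed-lattice `β → ∞` asymptotics exist only for the free energy). -/
def AxisGaussianLower : Prop :=
  ∀ (G : Type) [Group G] [TopologicalSpace G] [IsTopologicalGroup G] [CompactSpace G]
      [MeasurableSpace G] [BorelSpace G], IsCompactSimpleLieGroup G →
    ∀ (r : LatticeRep G), ∃ κ : ℝ, 0 < κ ∧ ∀ (L : ℕ) [NeZero L], ∃ B : ℝ, ∀ (β : ℝ), B ≤ β →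
      ∀ (n : ℕ), 1 ≤ n → 8 * n ≤ L →
        κ * (((2 * Literature.Probability.LatticeModels.torusGreen
                  (Pi.single (2 : Fin 4) ((n : ℕ) : ZMod L) : Fin 4 → ZMod L)
                - Literature.Probability.LatticeModels.torusGreen
                  ((Pi.single (2 : Fin 4) ((n : ℕ) : ZMod L) : Fin 4 → ZMod L)
                    + Pi.single (0 : Fin 4) (1 : ZMod L))
                - Literature.Probability.LatticeModels.torusGreen
                  ((Pi.single (2 : Fin 4) ((n : ℕ) : ZMod L) : Fin 4 → ZMod L)
                    - Pi.single (0 : Fin 4) (1 : ZMod L)))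
              + (2 * Literature.Probability.LatticeModels.torusGreen
                  (Pi.single (2 : Fin 4) ((n : ℕ) : ZMod L) : Fin 4 → ZMod L)
                - Literature.Probability.LatticeModels.torusGreen
                  ((Pi.single (2 : Fin 4) ((n : ℕ) : ZMod L) : Fin 4 → ZMod L)
                    + Pi.single (1 : Fin 4) (1 : ZMod L))
                - Literature.Probability.LatticeModels.torusGreen
                  ((Pi.single (2 : Fin 4) ((n : ℕ) : ZMod L) : Fin 4 → ZMod L)
                    - Pi.single (1 : Fin 4) (1 : ZMod L)))) / 2) ^ 2
          ≤ β ^ 2 *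
            (wilsonExpectation r.ρ β (fun U : GaugeConfig 4 L G =>
                ((r.N : ℝ) - (r.ρ (plaquetteHolonomy U 0 0 1)).trace.re) *
                  ((r.N : ℝ) - (r.ρ (plaquetteHolonomy U
                    (Pi.single (2 : Fin 4) ((n : ℕ) : ZMod L)) 0 1)).trace.re))
              - wilsonExpectation r.ρ β (fun U : GaugeConfig 4 L G =>
                  (r.N : ℝ) - (r.ρ (plaquetteHolonomy U 0 0 1)).trace.re)
                * wilsonExpectation r.ρ β (fun U : GaugeConfig 4 L G =>
                  (r.N : ℝ) - (r.ρ (plaquetteHolonomy U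
                    (Pi.single (2 : Fin 4) ((n : ℕ) : ZMod L)) 0 1)).trace.re))

/-- **W — Wick / Isserlis covariance of squares** (readable copy of the statement of `stub_wickSquares`;
reshape c2). For a centred multivariate Gaussian vector `a` on `ι` with (positive semidefinite)
covariance matrix `S` and two linear functionals `X = ∑ uᵢ aᵢ`, `Y = ∑ vᵢ aᵢ`:
`E[X² Y²] − E[X²] E[Y²] = 2 (uᵀ S v)² = 2 Cov(X, Y)²` (Isserlis 1918; Wick 1950). Provable now from
Mathlib's `multivariateGaussian` (polarisation `12 X²Y² = (X+Y)⁴ + (X−Y)⁴ − 2X⁴ − 2Y⁴` and the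
fourth moment `3σ⁴` of `gaussianReal`). -/
def WickSquares : Prop :=
  ∀ (ι : Type) [Fintype ι] [DecidableEq ι] (S : Matrix ι ι ℝ), S.PosSemidef →
    ∀ (u v : ι → ℝ),
      (∫ x, (∑ i, u i * x i) ^ 2 * (∑ i, v i * x i) ^ 2 ∂(multivariateGaussian 0 S))
        - (∫ x, (∑ i, u i * x i) ^ 2 ∂(multivariateGaussian 0 S))
          * (∫ x, (∑ i, v i * x i) ^ 2 ∂(multivariateGaussian 0 S))
      = 2 * (u ⬝ᵥ S *ᵥ v) ^ 2

/-- **F — the reference lattice Maxwell covariance and its field-strength kernel** (readable copy of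
the statement of `stub_fieldStrengthCovariance`; reshape c2). On the torus `(ℤ/L)⁴`, the Feynman-gauge
covariance of the Gaussian 1-form `a`, `S_L((x,μ),(y,ν)) = δ_{μν} G_L(x − y)` with `G_L = torusGreen`
(twice the Green function of `−Δ` on mean-zero functions), is positive semidefinite (Fourier sum with
weights `1/ε(p_k) ≥ 0`), and for the plaquette field strength
`F₀₁(x) = a(x,0) + a(x+e₀,1) − a(x+e₁,0) − a(x,1)` (coefficient vector `u x`):
`⟨F₀₁(x) F₀₁(y)⟩ = (u x)ᵀ S_L (u y) = 2 K_L(x − y)`, `K_L` the K1a kernel (half the sum of the two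
negative second differences of `G_L` in the plaquette directions). Provable now (finite sums). -/
def FieldStrengthCovariance : Prop :=
  ∀ (L : ℕ) [NeZero L] (S : Matrix (Edge 4 L) (Edge 4 L) ℝ) (u : (Fin 4 → ZMod L) → Edge 4 L → ℝ),
    (S = fun e e' => if e.2 = e'.2 then
        Literature.Probability.LatticeModels.torusGreen (e.1 - e'.1) else 0) →
    (u = fun x e =>
        (if e = (x, (0 : Fin 4)) then (1 : ℝ) else 0)
        + (if e = (x + Pi.single (0 : Fin 4) (1 : ZMod L), (1 : Fin 4)) then 1 else 0)
        - (if e = (x + Pi.single (1 : Fin 4) (1 : ZMod L), (0 : Fin 4)) then 1 else 0)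
        - (if e = (x, (1 : Fin 4)) then 1 else 0)) →
    S.PosSemidef ∧
    ∀ (x y : Fin 4 → ZMod L),
      u x ⬝ᵥ S *ᵥ u y =
        2 * (((2 * Literature.Probability.LatticeModels.torusGreen (x - y)
              - Literature.Probability.LatticeModels.torusGreen
                  ((x - y) + Pi.single (0 : Fin 4) (1 : ZMod L))
              - Literature.Probability.LatticeModels.torusGreen
                  ((x - y) - Pi.single (0 : Fin 4) (1 : ZMod L)))
            + (2 * Literature.Probability.LatticeModels.torusGreen (x - y)
              - Literature.Probability.LatticeModels.torusGreen
                  ((x - y) + Pi.single (1 : Fin 4) (1 : ZMod L))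
              - Literature.Probability.LatticeModels.torusGreen
                  ((x - y) - Pi.single (1 : Fin 4) (1 : ZMod L)))) / 2)

/-- **GD-dom — Gaussian domination from BELOW of the axis covariance (the crux-sized core of GD⁻;
readable copy of the statement of `stub_axisGaussianDomination`; reshape c2).** For every compact simple
`G` and faithful unitary `r` there is ONE `κ > 0` and per-torus thresholds `B(L)` such that for
`β ≥ B(L)`, `1 ≤ n ≤ L/8`:
`κ · Cov_{γ_L}(F₀₁(ne₂)², F₀₁(0)²) ≤ β² · Cov_{L,β}(P_0^{01}, P_{ne₂}^{01})`, where `γ_L =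
multivariateGaussian 0 S_L` is the reference lattice Maxwell field of `FieldStrengthCovariance` (ONE
colour; the `dim G` colours and the normalisation `P ≈ |F|²/(2β)` are absorbed in `κ`). By W and F the
left side is `8κ K_L(ne₂)²`, so GD-dom is GD⁻ with the reference-Gaussian computation factored out
(`axisGaussianLower_of_domination`). Content (unchanged): second-order Laplace asymptotics of Wilson's
measure on `G^E` near the singular flat-connection variety — leading Gaussian term by the law of total
covariance over the flat background, toron part `≥ 0` on the axis, twisted kernels within `O(L⁻⁴)`.
Not in print for any non-abelian `G`. -/
def AxisGaussianDomination : Prop :=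
  ∀ (G : Type) [Group G] [TopologicalSpace G] [IsTopologicalGroup G] [CompactSpace G]
      [MeasurableSpace G] [BorelSpace G], IsCompactSimpleLieGroup G →
    ∀ (r : LatticeRep G), ∃ κ : ℝ, 0 < κ ∧ ∀ (L : ℕ) [NeZero L], ∃ B : ℝ, ∀ (β : ℝ), B ≤ β →
      ∀ (S : Matrix (Edge 4 L) (Edge 4 L) ℝ) (u : (Fin 4 → ZMod L) → Edge 4 L → ℝ),
      (S = fun e e' => if e.2 = e'.2 then
          Literature.Probability.LatticeModels.torusGreen (e.1 - e'.1) else 0) →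
      (u = fun x e =>
          (if e = (x, (0 : Fin 4)) then (1 : ℝ) else 0)
          + (if e = (x + Pi.single (0 : Fin 4) (1 : ZMod L), (1 : Fin 4)) then 1 else 0)
          - (if e = (x + Pi.single (1 : Fin 4) (1 : ZMod L), (0 : Fin 4)) then 1 else 0)
          - (if e = (x, (1 : Fin 4)) then 1 else 0)) →
      ∀ (n : ℕ), 1 ≤ n → 8 * n ≤ L →
        κ * ((∫ a, (∑ e, u (Pi.single (2 : Fin 4) ((n : ℕ) : ZMod L)) e * a e) ^ 2
                  * (∑ e, u 0 e * a e) ^ 2 ∂(multivariateGaussian 0 S))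
              - (∫ a, (∑ e, u (Pi.single (2 : Fin 4) ((n : ℕ) : ZMod L)) e * a e) ^ 2
                    ∂(multivariateGaussian 0 S))
                * (∫ a, (∑ e, u 0 e * a e) ^ 2 ∂(multivariateGaussian 0 S)))
          ≤ β ^ 2 *
            (wilsonExpectation r.ρ β (fun U : GaugeConfig 4 L G =>
                ((r.N : ℝ) - (r.ρ (plaquetteHolonomy U 0 0 1)).trace.re) *
                  ((r.N : ℝ) - (r.ρ (plaquetteHolonomy U
                    (Pi.single (2 : Fin 4) ((n : ℕ) : ZMod L)) 0 1)).trace.re))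
              - wilsonExpectation r.ρ β (fun U : GaugeConfig 4 L G =>
                  (r.N : ℝ) - (r.ρ (plaquetteHolonomy U 0 0 1)).trace.re)
                * wilsonExpectation r.ρ β (fun U : GaugeConfig 4 L G =>
                  (r.N : ℝ) - (r.ρ (plaquetteHolonomy U
                    (Pi.single (2 : Fin 4) ((n : ℕ) : ZMod L)) 0 1)).trace.re))

/-- **OA — off-axis domination (reflection-positivity Cauchy–Schwarz; β-uniform, every compact `G`).**
For every direction `μ` in which the two base points differ (`m = |(y−x)_μ| ≥ 1`, torus distance in
that coordinate), the covariance of ANY two plaquette fields is dominated by the diagonal (same-family)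
covariances along `μ` in the window `{m−1, m, m+1}`:
`Cov(P_x^{ij}, P_y^{i'j'})² ≤ (Σ_{s=m−1}^{m+1} |D^{ij}_μ(s)|) · (Σ_{s=m−1}^{m+1} |D^{i'j'}_μ(s)|)`,
`D^{ij}_μ(s) = Cov(P_0^{ij}, P_{s e_μ}^{ij})`. -/
def OffAxisDomination : Prop :=
  ∀ (G : Type) [Group G] [TopologicalSpace G] [IsTopologicalGroup G] [CompactSpace G]
      [MeasurableSpace G] [BorelSpace G] (N : ℕ) (ρ : G →* Matrix (Fin N) (Fin N) ℂ), Continuous ρ →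
    ∀ (L : ℕ) [NeZero L] (β : ℝ), 0 ≤ β →
      ∀ (P : (Fin 4 → ZMod L) → Fin 4 → Fin 4 → GaugeConfig 4 L G → ℝ)
        (E : (GaugeConfig 4 L G → ℝ) → ℝ),
        (P = fun x i j U => (N : ℝ) - (ρ (plaquetteHolonomy U x i j)).trace.re) →
        (E = fun F => wilsonExpectation ρ β F) →
      ∀ (μ : Fin 4) (x y : Fin 4 → ZMod L) (i j i' j' : Fin 4), i ≠ j → i' ≠ j' →
        1 ≤ ((y μ - x μ).valMinAbs).natAbs →
        (E (fun U => P x i j U * P y i' j' U) - E (P x i j) * E (P y i' j')) ^ 2 ≤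
          (∑ s ∈ Finset.range 3,
              |E (fun U => P 0 i j U *
                  P (Pi.single μ ((((y μ - x μ).valMinAbs).natAbs - 1 + s : ℕ) : ZMod L)) i j U)
                - E (P 0 i j) *
                  E (P (Pi.single μ ((((y μ - x μ).valMinAbs).natAbs - 1 + s : ℕ) : ZMod L)) i j)|) *
          (∑ s ∈ Finset.range 3,
              |E (fun U => P 0 i' j' U *
                  P (Pi.single μ ((((y μ - x μ).valMinAbs).natAbs - 1 + s : ℕ) : ZMod L)) i' j' U)
                - E (P 0 i' j') *
                  E (P (Pi.single μ ((((y μ - x μ).valMinAbs).natAbs - 1 + s : ℕ) : ZMod L)) i' j')|)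

/-- **DU — fixed-torus upper bounds for the DIAGONAL families only (the XL residue of K2⁺).** ONE `C`,
per-torus thresholds: `β² Var P ≤ C` and `β² |D^{ij}_μ(s)| · min(s, L−s)⁸ ≤ C` for `1 ≤ s ≤ L−1`,
all 24 families `(i, j, μ)`. -/
def DiagUpperFixedTorus : Prop :=
  ∀ (G : Type) [Group G] [TopologicalSpace G] [IsTopologicalGroup G] [CompactSpace G]
      [MeasurableSpace G] [BorelSpace G], IsCompactSimpleLieGroup G →
    ∀ (r : LatticeRep G), ∃ (B : ℕ → ℝ) (C : ℝ),
      ∀ (L : ℕ) [NeZero L] (β : ℝ), B L ≤ β →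
      ∀ (P : (Fin 4 → ZMod L) → Fin 4 → Fin 4 → GaugeConfig 4 L G → ℝ)
        (E : (GaugeConfig 4 L G → ℝ) → ℝ),
        (P = fun x i j U => (r.N : ℝ) - (r.ρ (plaquetteHolonomy U x i j)).trace.re) →
        (E = fun F => wilsonExpectation r.ρ β F) →
      (∀ (i j : Fin 4), i ≠ j →
          β ^ 2 * |E (fun U => P 0 i j U * P 0 i j U) - E (P 0 i j) * E (P 0 i j)| ≤ C) ∧
      (∀ (i j μ : Fin 4) (s : ℕ), i ≠ j → 1 ≤ s → s + 1 ≤ L →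
          β ^ 2 * (|E (fun U => P 0 i j U * P (Pi.single μ ((s : ℕ) : ZMod L)) i j U)
              - E (P 0 i j) * E (P (Pi.single μ ((s : ℕ) : ZMod L)) i j)|
            * (min (s : ℝ) ((L : ℝ) - s)) ^ 8) ≤ C)

/-- **DU₂ — fixed-torus upper bounds for the TWO diagonal profiles (reshape c1, second pass).** ONE
`C`, per-torus thresholds: `β² Var P_0^{01} ≤ C`, and for `1 ≤ s ≤ L − 1` the transverse profile
`β² |Cov(P_0^{01}, P_{s e₂}^{01})| · min(s, L−s)⁸ ≤ C` (the crux's own axis family) and the longitudinal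
profile `β² |Cov(P_0^{01}, P_{s e₀}^{01})| · min(s, L−s)⁸ ≤ C`. By the landed hypercubic reduction
`Theorems.FemtoCurvatureTwoPoint.diagFamilies_two_profiles` this is equivalent to the 24-family
statement `DiagUpperFixedTorus` (glue `diagUpper_of_twoProfiles` below). -/
def DiagUpperTwoProfiles : Prop :=
  ∀ (G : Type) [Group G] [TopologicalSpace G] [IsTopologicalGroup G] [CompactSpace G]
      [MeasurableSpace G] [BorelSpace G], IsCompactSimpleLieGroup G →
    ∀ (r : LatticeRep G), ∃ (B : ℕ → ℝ) (C : ℝ),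
      ∀ (L : ℕ) [NeZero L] (β : ℝ), B L ≤ β →
      ∀ (P : (Fin 4 → ZMod L) → Fin 4 → Fin 4 → GaugeConfig 4 L G → ℝ)
        (E : (GaugeConfig 4 L G → ℝ) → ℝ),
        (P = fun x i j U => (r.N : ℝ) - (r.ρ (plaquetteHolonomy U x i j)).trace.re) →
        (E = fun F => wilsonExpectation r.ρ β F) →
      β ^ 2 * |E (fun U => P 0 0 1 U * P 0 0 1 U) - E (P 0 0 1) * E (P 0 0 1)| ≤ C ∧
      ∀ (s : ℕ), 1 ≤ s → s + 1 ≤ L →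
        β ^ 2 * (|E (fun U => P 0 0 1 U * P (Pi.single (2 : Fin 4) ((s : ℕ) : ZMod L)) 0 1 U)
            - E (P 0 0 1) * E (P (Pi.single (2 : Fin 4) ((s : ℕ) : ZMod L)) 0 1)|
          * (min (s : ℝ) ((L : ℝ) - s)) ^ 8) ≤ C ∧
        β ^ 2 * (|E (fun U => P 0 0 1 U * P (Pi.single (0 : Fin 4) ((s : ℕ) : ZMod L)) 0 1 U)
            - E (P 0 0 1) * E (P (Pi.single (0 : Fin 4) ((s : ℕ) : ZMod L)) 0 1)|
          * (min (s : ℝ) ((L : ℝ) - s)) ^ 8) ≤ C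

/-- **RV — regular variation of the fixed-torus Wilson partition function** (NAMED FACT; readable copy of
the statement of `stub_wilsonPartitionRV`; reshape c2 second pass). `Z_L(β) · β^λ / (log β)^m → C > 0`
for some `λ ≥ 0`, `m ∈ ℕ`: Watanabe 2009 Thm. 7.1(1) / Arnold–Gusein-Zade–Varchenko II Thm. 7.6 for the
analytic phase `S` (Wilson action) on the compact real-analytic manifold `G^E` with the Haar amplitude. -/
def WilsonPartitionRegularVariation : Prop :=
  ∀ (G : Type) [Group G] [TopologicalSpace G] [IsTopologicalGroup G] [CompactSpace G]
      [MeasurableSpace G] [BorelSpace G] (r : LatticeRep G) (L : ℕ) [NeZero L],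
    ∃ (C lam : ℝ) (m : ℕ), 0 < C ∧ 0 ≤ lam ∧
      Tendsto (fun β : ℝ =>
        (partitionFunction (d := 4) (L := L) r.ρ β).toReal * β ^ lam / Real.log β ^ m)
        atTop (nhds C)

/-- **DBL — doubling of the fixed-torus partition function** (readable copy of the conclusion of
`stub_doubling_of_RV`): ONE `A`, per-torus thresholds, `Z_L(β/2) ≤ e^{A L⁴} Z_L(β)`. -/
def FixedTorusDoubling : Prop :=
  ∀ (G : Type) [Group G] [TopologicalSpace G] [IsTopologicalGroup G] [CompactSpace G]
      [MeasurableSpace G] [BorelSpace G] (r : LatticeRep G), ∃ A : ℝ, ∀ (L : ℕ) [NeZero L],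
    ∃ B : ℝ, ∀ β : ℝ, B ≤ β →
      (partitionFunction (d := 4) (L := L) r.ρ (β / 2)).toReal ≤
        Real.exp (A * (L : ℝ) ^ 4) * (partitionFunction (d := 4) (L := L) r.ρ β).toReal

/-- **RPCS — reflection Cauchy–Schwarz for products of `01`-plaquette functions** (readable copy of the
statement of `stub_plaquetteProductRPCS`): on an even torus, for `f ≥ 0` bounded measurable and
`ψ(S) = E[∏_{x∈S} f(P_{(x;01)})]`, `ψ(S)² ≤ ψ(symP i k S) ψ(symM i k S)` for every block reflection
(cells = base points; in-plane directions by site reflections, transverse directions by link reflections). -/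
def PlaquetteProductRPCS : Prop :=
  ∀ (G : Type) [Group G] [TopologicalSpace G] [IsTopologicalGroup G] [CompactSpace G]
      [MeasurableSpace G] [BorelSpace G] (N : ℕ) (ρ : G →* Matrix (Fin N) (Fin N) ℂ),
    Continuous ρ → (∀ g, ρ g ∈ Matrix.unitaryGroup (Fin N) ℂ) →
    ∀ (L : ℕ) [NeZero L], Even L → ∀ (β : ℝ), 0 ≤ β →
    ∀ (f : ℝ → ℝ), Measurable f → (∀ t, 0 ≤ f t) → (∃ M : ℝ, ∀ t, f t ≤ M) →
    ∀ (ψ : Finset (Fin 4 → ZMod L) → ℝ),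
      (ψ = fun S => wilsonExpectation (d := 4) (L := L) ρ β
        (fun U => ∏ x ∈ S, f ((N : ℝ) - (ρ (plaquetteHolonomy U x 0 1)).trace.re))) →
      ∀ (i : Fin 4) (k : ZMod L) (S : Finset (Fin 4 → ZMod L)),
        ψ S ^ 2 ≤ ψ (symP i k S) * ψ (symM i k S)

/-- **CHESS — chessboard estimate for the `01`-plaquette field on dyadic tori** (readable copy of the
conclusion of `stub_chessboard_of_RPCS`): `E f(P_0) ≤ (E ∏_x f(P_x))^{1/L⁴}` (FILS 1978 Thm. 2.2). -/
def PlaquetteChessboardDyadic : Prop :=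
  ∀ (G : Type) [Group G] [TopologicalSpace G] [IsTopologicalGroup G] [CompactSpace G]
      [MeasurableSpace G] [BorelSpace G] (N : ℕ) (ρ : G →* Matrix (Fin N) (Fin N) ℂ),
    Continuous ρ → (∀ g, ρ g ∈ Matrix.unitaryGroup (Fin N) ℂ) →
    ∀ (n L : ℕ) [NeZero L], L = 2 ^ (n + 1) → ∀ (β : ℝ), 0 ≤ β →
    ∀ (f : ℝ → ℝ), Measurable f → (∀ t, 0 ≤ f t) → (∃ M : ℝ, ∀ t, f t ≤ M) →
      wilsonExpectation (d := 4) (L := L) ρ β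
          (fun U => f ((N : ℝ) - (ρ (plaquetteHolonomy U 0 0 1)).trace.re)) ≤
        (wilsonExpectation (d := 4) (L := L) ρ β
          (fun U => ∏ x : Fin 4 → ZMod L, f ((N : ℝ) - (ρ (plaquetteHolonomy U x 0 1)).trace.re)))
          ^ ((1 : ℝ) / (L : ℝ) ^ 4)

/-- **VAR — the variance clause of DU₂ on dyadic tori** (readable copy of the conclusion of
`stub_variance_of_chessboard_doubling`). -/
def PlaquetteVarianceDyadic : Prop :=
  ∀ (G : Type) [Group G] [TopologicalSpace G] [IsTopologicalGroup G] [CompactSpace G]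
      [MeasurableSpace G] [BorelSpace G], IsCompactSimpleLieGroup G →
    ∀ (r : LatticeRep G), ∃ (B : ℕ → ℝ) (C : ℝ),
      ∀ (n L : ℕ) [NeZero L], L = 2 ^ (n + 1) → ∀ (β : ℝ), B L ≤ β →
      ∀ (P : (Fin 4 → ZMod L) → Fin 4 → Fin 4 → GaugeConfig 4 L G → ℝ)
        (E : (GaugeConfig 4 L G → ℝ) → ℝ),
        (P = fun x i j U => (r.N : ℝ) - (r.ρ (plaquetteHolonomy U x i j)).trace.re) →
        (E = fun F => wilsonExpectation r.ρ β F) →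
      β ^ 2 * |E (fun U => P 0 0 1 U * P 0 0 1 U) - E (P 0 0 1) * E (P 0 0 1)| ≤ C

/-- **REST — DU₂ without the dyadic variance clause** (readable copy of the statement of
`stub_diagUpperRest`; the crux-sized remainder: variance on non-dyadic tori and the two profiles). -/
def DiagUpperRest : Prop :=
  ∀ (G : Type) [Group G] [TopologicalSpace G] [IsTopologicalGroup G] [CompactSpace G]
      [MeasurableSpace G] [BorelSpace G], IsCompactSimpleLieGroup G →
    ∀ (r : LatticeRep G), ∃ (B : ℕ → ℝ) (C : ℝ),
      ∀ (L : ℕ) [NeZero L] (β : ℝ), B L ≤ β →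
      ∀ (P : (Fin 4 → ZMod L) → Fin 4 → Fin 4 → GaugeConfig 4 L G → ℝ)
        (E : (GaugeConfig 4 L G → ℝ) → ℝ),
        (P = fun x i j U => (r.N : ℝ) - (r.ρ (plaquetteHolonomy U x i j)).trace.re) →
        (E = fun F => wilsonExpectation r.ρ β F) →
      ((∀ n : ℕ, L ≠ 2 ^ (n + 1)) →
        β ^ 2 * |E (fun U => P 0 0 1 U * P 0 0 1 U) - E (P 0 0 1) * E (P 0 0 1)| ≤ C) ∧
      ∀ (s : ℕ), 1 ≤ s → s + 1 ≤ L →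
        β ^ 2 * (|E (fun U => P 0 0 1 U * P (Pi.single (2 : Fin 4) ((s : ℕ) : ZMod L)) 0 1 U)
            - E (P 0 0 1) * E (P (Pi.single (2 : Fin 4) ((s : ℕ) : ZMod L)) 0 1)|
          * (min (s : ℝ) ((L : ℝ) - s)) ^ 8) ≤ C ∧
        β ^ 2 * (|E (fun U => P 0 0 1 U * P (Pi.single (0 : Fin 4) ((s : ℕ) : ZMod L)) 0 1 U)
            - E (P 0 0 1) * E (P (Pi.single (0 : Fin 4) ((s : ℕ) : ZMod L)) 0 1)|
          * (min (s : ℝ) ((L : ℝ) - s)) ^ 8) ≤ C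

/-- **C⁺ of the card (`FixedTorusSemiclassicalTwoPoint`, sharpened threshold form).** Both
clauses with ONE pair of constants `0 < c`, `C` uniform in `L`, each torus from its own
threshold `B(L)` on. No unit map, no shape, no coupling between `β` and `L`. -/
def FixedTorusTwoSided : Prop :=
  ∀ (G : Type) [Group G] [TopologicalSpace G] [IsTopologicalGroup G] [CompactSpace G],
    IsCompactSimpleLieGroup G →
    letI : MeasurableSpace G := borel G
    haveI : BorelSpace G := ⟨rfl⟩
    ∀ (r : LatticeRep G), ∃ (B : ℕ → ℝ) (c C : ℝ), 0 < c ∧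
      ∀ (L : ℕ) [NeZero L] (β : ℝ), B L ≤ β →
        let P : (Fin 4 → ZMod L) → Fin 4 → Fin 4 → GaugeConfig 4 L G → ℝ :=
          fun x i j U => (r.N : ℝ) - (r.ρ (plaquetteHolonomy U x i j)).trace.re
        let E : (GaugeConfig 4 L G → ℝ) → ℝ := fun F => wilsonExpectation (d := 4) (L := L) r.ρ β F
        let cov : (GaugeConfig 4 L G → ℝ) → (GaugeConfig 4 L G → ℝ) → ℝ :=
          fun F F' => E (fun U => F U * F' U) - E F * E F'
        let dist : (Fin 4 → ZMod L) → (Fin 4 → ZMod L) → ℝ :=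
          fun x y => Real.sqrt (∑ k : Fin 4, (((x k - y k).valMinAbs : ℤ) : ℝ) ^ 2)
        (∀ n : ℕ, 1 ≤ n → 8 * n ≤ L →
            c ≤ β ^ 2 * ((n : ℝ) ^ 8 * cov (P 0 0 1) (P (Pi.single (2 : Fin 4) ((n : ℕ) : ZMod L)) 0 1)) ∧
            β ^ 2 * ((n : ℝ) ^ 8 * cov (P 0 0 1) (P (Pi.single (2 : Fin 4) ((n : ℕ) : ZMod L)) 0 1)) ≤ C) ∧
        (∀ (x y : Fin 4 → ZMod L) (i j i' j' : Fin 4), x ≠ y → i ≠ j → i' ≠ j' →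
            β ^ 2 * (|cov (P x i j) (P y i' j')| * dist x y ^ 8) ≤ C)

/-- The crux BODY at fixed data `(G, r)` (verbatim; `femtoCurvatureTwoPoint_iff_cruxAt` is `Iff.rfl`).
Used only to state the fixed-data form `encoding_at` of the transfer. -/
def CruxAt {G : Type} [Group G] [TopologicalSpace G] [IsTopologicalGroup G] [CompactSpace G]
    [MeasurableSpace G] [BorelSpace G] (r : LatticeRep G) : Prop :=
  ∃ (a : ℝ → ℝ), ∃ (Γ : ℝ → ℝ) (β₀ ℓ₀ c C : ℝ), 0 < ℓ₀ ∧ 0 < c ∧ (∀ β, 0 < a β) ∧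
    Filter.Tendsto a Filter.atTop (nhds 0) ∧ (∀ s : ℝ, 0 < s → s ≤ ℓ₀ → 0 < Γ s ∧ Γ s ≤ 1) ∧
    ∀ (L : ℕ) [NeZero L] (β : ℝ), β₀ ≤ β → (L : ℝ) * a β ≤ ℓ₀ →
      let P : (Fin 4 → ZMod L) → Fin 4 → Fin 4 → GaugeConfig 4 L G → ℝ :=
        fun x i j U => (r.N : ℝ) - (r.ρ (plaquetteHolonomy U x i j)).trace.re
      let E : (GaugeConfig 4 L G → ℝ) → ℝ := fun F => wilsonExpectation (d := 4) (L := L) r.ρ β F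
      let cov : (GaugeConfig 4 L G → ℝ) → (GaugeConfig 4 L G → ℝ) → ℝ :=
        fun F F' => E (fun U => F U * F' U) - E F * E F'
      let dist : (Fin 4 → ZMod L) → (Fin 4 → ZMod L) → ℝ :=
        fun x y => Real.sqrt (∑ k : Fin 4, (((x k - y k).valMinAbs : ℤ) : ℝ) ^ 2)
      (∀ n : ℕ, 1 ≤ n → 8 * n ≤ L →
          c * Γ ((n : ℝ) * a β) ≤ (n : ℝ) ^ 8 * cov (P 0 0 1) (P (Pi.single (2 : Fin 4) ((n : ℕ) : ZMod L)) 0 1) ∧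
          (n : ℝ) ^ 8 * cov (P 0 0 1) (P (Pi.single (2 : Fin 4) ((n : ℕ) : ZMod L)) 0 1) ≤ C * Γ ((n : ℝ) * a β)) ∧
      (∀ (x y : Fin 4 → ZMod L) (i j i' j' : Fin 4), x ≠ y → i ≠ j → i' ≠ j' →
          |cov (P x i j) (P y i' j')| * dist x y ^ 8 ≤ C * Γ (dist x y * a β))

/-- The crux is literally `∀ G simple compact, ∀ r, CruxAt r` (definitional unbundling, as in
`Disproof.femtoCurvatureTwoPoint_iff`). -/
theorem femtoCurvatureTwoPoint_iff_cruxAt :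
    Summit.QuantumFields.YangMills.Theses.LangevinControlUV.FemtoCurvatureTwoPoint ↔
      ∀ (G : Type) [Group G] [TopologicalSpace G] [IsTopologicalGroup G] [CompactSpace G],
        IsCompactSimpleLieGroup G →
          letI : MeasurableSpace G := borel G
          haveI : BorelSpace G := ⟨rfl⟩
          ∀ r : LatticeRep G, CruxAt r :=
  Iff.rfl

/-! ## § Stubs (registered; genuine lemmas of the line)

Shape (lead's reshape): every stub's TYPE is written out in full with Mathlib/Literature names only
(no skeleton-local definition occurs in a registered signature), so a stub file under `Theorems/`
states and proves it verbatim; the readable `def`s of § Statements are definitionally the same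
propositions (`Iff.rfl`, see `§ Handles`). Status after wave 1 (2026-08-16): K1a and K1b are
PROVED (Literature `MaxwellKernelBand`, `TorusGreenHessianDecay` + the landed stub file
`Theorems/LangevinControlUVFemtoCurvatureTwoPointStubGreenHessianDecay`); after the lead-c1
reshapes (GD⁺ retired; OA proved and LANDED as `Theorems/…OffAxis{Engines,Core,Domination}`; the 24
diagonal families reduced to two profiles by the LANDED `Theorems/…DiagFamilies`) the two remaining
`sorry`s were GD⁻ (`stub_axisGaussianLower`) and the two-profile upper bound DU₂ (`stub_diagUpper`) —
one missing theory: toron-aware second-order Laplace asymptotics of Wilson's measure on the fixed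
torus (constants uniform in `L`, thresholds `B(L)` free); K2⁻/K2⁺ are factored into them through the
proved reductions `axisLower_of` / `pairUpper_of'` / `diagUpper_of_twoProfiles`. Lead-c2 reshape
(2026-08-16T15:40Z): GD⁻ is factored as W ∧ F ∧ GD-dom (`stub_wickSquares`, `stub_fieldStrengthCovariance`
— both provable now — and the core `stub_axisGaussianDomination`), glue `axisGaussianLower_of_domination`
proved; the registered `sorry`s were then W, F, GD-dom, DU₂; W and F LANDED (p111302, p110989) in wave 1.
Lead-c2 second reshape (18:30Z): DU₂ factored as VAR (dyadic variance via chessboard + `Z_L` doubling)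
∧ REST; registered `sorry`s: GD-dom, REST (core), RPCS, CHESS-of-RPCS, VAR-of-(CHESS,DBL), DBL-of-RV
(provable), RV (named fact). -/

/-- **stub K1a** — VERBATIM the deep-band line's `stub_maxwellKernelBand`: `c ≤ n⁴ K_L(ne₂) ≤ C`
for `1 ≤ n`, `8n ≤ L`, uniformly in `L`. PROVED (stub-worker w-kernelband, cycle-resolvent route:
Literature `CycleResolvent`, `CycleMomentumEstimates`, `MaxwellKernelTransverse`, `MaxwellKernelBand`;
stub file p94229). -/
theorem stub_maxwellKernelBand :
    ∃ (c C : ℝ), 0 < c ∧ ∀ (L : ℕ) [NeZero L] (e₀ e₁ : Fin 4 → ZMod L) (K : (Fin 4 → ZMod L) → ℝ),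
      e₀ = Pi.single (0 : Fin 4) (1 : ZMod L) → e₁ = Pi.single (1 : Fin 4) (1 : ZMod L) →
      (K = fun z =>
        ((2 * Literature.Probability.LatticeModels.torusGreen z
            - Literature.Probability.LatticeModels.torusGreen (z + e₀)
            - Literature.Probability.LatticeModels.torusGreen (z - e₀))
          + (2 * Literature.Probability.LatticeModels.torusGreen z
            - Literature.Probability.LatticeModels.torusGreen (z + e₁)
            - Literature.Probability.LatticeModels.torusGreen (z - e₁))) / 2) →
      ∀ (n : ℕ), 1 ≤ n → 8 * n ≤ L →
        c ≤ (n : ℝ) ^ 4 * K (Pi.single (2 : Fin 4) ((n : ℕ) : ZMod L)) ∧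
          (n : ℝ) ^ 4 * K (Pi.single (2 : Fin 4) ((n : ℕ) : ZMod L)) ≤ C := by
  obtain ⟨c, C, hc, h⟩ := Literature.Probability.LatticeModels.torusGreen_second_difference_axis_band
  refine ⟨c, C, hc, ?_⟩
  intro L _ e₀ e₁ K he₀ he₁ hK n hn h8
  subst he₀ he₁ hK
  obtain ⟨h0l, h0u⟩ := h L 0 2 (by decide) n hn h8
  obtain ⟨h1l, h1u⟩ := h L 1 2 (by decide) n hn h8
  simp only
  constructor
  · linarith
  · linarith

/-- **stub W** (reshape c2; PROVED by stub-worker w-wick and LANDED as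
`Theorems/LangevinControlUVFemtoCurvatureTwoPointStubWickSquares` p111302 — Isserlis/Wick for
Mathlib's `multivariateGaussian`, via the 1-D moments of Literature `GaussianMoments`):
covariance of the squares of two linear functionals of a centred Gaussian vector with positive
semidefinite covariance matrix `S`: `E[X²Y²] − E[X²]E[Y²] = 2 (uᵀ S v)²`. -/
theorem stub_wickSquares :
    ∀ (ι : Type) [Fintype ι] [DecidableEq ι] (S : Matrix ι ι ℝ), S.PosSemidef →
    ∀ (u v : ι → ℝ),
      (∫ x, (∑ i, u i * x i) ^ 2 * (∑ i, v i * x i) ^ 2 ∂(multivariateGaussian 0 S))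
        - (∫ x, (∑ i, u i * x i) ^ 2 ∂(multivariateGaussian 0 S))
          * (∫ x, (∑ i, v i * x i) ^ 2 ∂(multivariateGaussian 0 S))
      = 2 * (u ⬝ᵥ S *ᵥ v) ^ 2 := by
  -- LANDED p111302 as `Summit.QuantumFields.YangMills.Theorems.FemtoCurvatureTwoPoint.stub_wickSquares`;
  -- `sorry` only until the farm snapshot contains the new module (then `exact` that decl).
  sorry

/-- **stub F** (reshape c2; PROVED by stub-worker w-fscov and LANDED as
`Theorems/LangevinControlUVFemtoCurvatureTwoPointStubFieldStrengthCovariance` p110989 — torus Fourier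
sums `torusGreen_neg`, `sum_sum_mul_torusGreen_nonneg` and finite-sum bookkeeping): the
Feynman-gauge lattice Maxwell covariance `S_L((x,μ),(y,ν)) = δ_{μν} torusGreen(x − y)` on the edges of
`(ℤ/L)⁴` is positive semidefinite, and the covariance of the plaquette field strengths
`F₀₁(x) = a(x,0) + a(x+e₀,1) − a(x+e₁,0) − a(x,1)` is `(u x)ᵀ S_L (u y) = 2 K_L(x − y)` with `K_L` the
K1a kernel. -/
theorem stub_fieldStrengthCovariance :
    ∀ (L : ℕ) [NeZero L] (S : Matrix (Edge 4 L) (Edge 4 L) ℝ) (u : (Fin 4 → ZMod L) → Edge 4 L → ℝ),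
      (S = fun e e' => if e.2 = e'.2 then
          Literature.Probability.LatticeModels.torusGreen (e.1 - e'.1) else 0) →
      (u = fun x e =>
          (if e = (x, (0 : Fin 4)) then (1 : ℝ) else 0)
          + (if e = (x + Pi.single (0 : Fin 4) (1 : ZMod L), (1 : Fin 4)) then 1 else 0)
          - (if e = (x + Pi.single (1 : Fin 4) (1 : ZMod L), (0 : Fin 4)) then 1 else 0)
          - (if e = (x, (1 : Fin 4)) then 1 else 0)) →
      S.PosSemidef ∧
      ∀ (x y : Fin 4 → ZMod L),
        u x ⬝ᵥ S *ᵥ u y =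
          2 * (((2 * Literature.Probability.LatticeModels.torusGreen (x - y)
                - Literature.Probability.LatticeModels.torusGreen
                    ((x - y) + Pi.single (0 : Fin 4) (1 : ZMod L))
                - Literature.Probability.LatticeModels.torusGreen
                    ((x - y) - Pi.single (0 : Fin 4) (1 : ZMod L)))
              + (2 * Literature.Probability.LatticeModels.torusGreen (x - y)
                - Literature.Probability.LatticeModels.torusGreen
                    ((x - y) + Pi.single (1 : Fin 4) (1 : ZMod L))
                - Literature.Probability.LatticeModels.torusGreen
                    ((x - y) - Pi.single (1 : Fin 4) (1 : ZMod L)))) / 2) := by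
  -- LANDED p110989 as `Summit.QuantumFields.YangMills.Theorems.FemtoCurvatureTwoPoint.stub_fieldStrengthCovariance`;
  -- `sorry` only until the farm snapshot contains the new module (then `exact` that decl).
  sorry

/-- **stub GD-dom** (HARDEST; the crux-sized core of GD⁻ — second-order singular Laplace asymptotics,
new mathematics; reshape c2 = GD⁻ with the reference-Gaussian computation factored out): Gaussian
domination from BELOW of the axis covariance on a fixed torus by the reference lattice Maxwell field
`multivariateGaussian 0 S_L`, ONE `κ`, per-torus thresholds. -/
theorem stub_axisGaussianDomination :
    ∀ (G : Type) [Group G] [TopologicalSpace G] [IsTopologicalGroup G] [CompactSpace G]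
      [MeasurableSpace G] [BorelSpace G], IsCompactSimpleLieGroup G →
    ∀ (r : LatticeRep G), ∃ κ : ℝ, 0 < κ ∧ ∀ (L : ℕ) [NeZero L], ∃ B : ℝ, ∀ (β : ℝ), B ≤ β →
      ∀ (S : Matrix (Edge 4 L) (Edge 4 L) ℝ) (u : (Fin 4 → ZMod L) → Edge 4 L → ℝ),
      (S = fun e e' => if e.2 = e'.2 then
          Literature.Probability.LatticeModels.torusGreen (e.1 - e'.1) else 0) →
      (u = fun x e =>
          (if e = (x, (0 : Fin 4)) then (1 : ℝ) else 0)
          + (if e = (x + Pi.single (0 : Fin 4) (1 : ZMod L), (1 : Fin 4)) then 1 else 0)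
          - (if e = (x + Pi.single (1 : Fin 4) (1 : ZMod L), (0 : Fin 4)) then 1 else 0)
          - (if e = (x, (1 : Fin 4)) then 1 else 0)) →
      ∀ (n : ℕ), 1 ≤ n → 8 * n ≤ L →
        κ * ((∫ a, (∑ e, u (Pi.single (2 : Fin 4) ((n : ℕ) : ZMod L)) e * a e) ^ 2
                  * (∑ e, u 0 e * a e) ^ 2 ∂(multivariateGaussian 0 S))
              - (∫ a, (∑ e, u (Pi.single (2 : Fin 4) ((n : ℕ) : ZMod L)) e * a e) ^ 2
                    ∂(multivariateGaussian 0 S))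
                * (∫ a, (∑ e, u 0 e * a e) ^ 2 ∂(multivariateGaussian 0 S)))
          ≤ β ^ 2 *
            (wilsonExpectation r.ρ β (fun U : GaugeConfig 4 L G =>
                ((r.N : ℝ) - (r.ρ (plaquetteHolonomy U 0 0 1)).trace.re) *
                  ((r.N : ℝ) - (r.ρ (plaquetteHolonomy U
                    (Pi.single (2 : Fin 4) ((n : ℕ) : ZMod L)) 0 1)).trace.re))
              - wilsonExpectation r.ρ β (fun U : GaugeConfig 4 L G =>
                  (r.N : ℝ) - (r.ρ (plaquetteHolonomy U 0 0 1)).trace.re)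
                * wilsonExpectation r.ρ β (fun U : GaugeConfig 4 L G =>
                  (r.N : ℝ) - (r.ρ (plaquetteHolonomy U
                    (Pi.single (2 : Fin 4) ((n : ℕ) : ZMod L)) 0 1)).trace.re)) := by
  sorry

/-- **Glue W ∧ F ∧ GD-dom ⇒ GD⁻ (proved; reshape c2).** The reference-Gaussian covariance of the two
squared field strengths is `2 · (2 K_L(ne₂))² = 8 K_L(ne₂)²` (Wick, then the kernel identity at
`(x, y) = (ne₂, 0)`), so GD-dom with constant `κ` is GD⁻ with constant `8κ`. -/
theorem axisGaussianLower_of_domination (hW : WickSquares) (hF : FieldStrengthCovariance)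
    (hD : AxisGaussianDomination) : AxisGaussianLower := by
  intro G _ _ _ _ _ _ hG r
  obtain ⟨κ, hκ, hL⟩ := hD G hG r
  refine ⟨8 * κ, by positivity, fun L _ => ?_⟩
  obtain ⟨B, hB⟩ := hL L
  refine ⟨B, fun β hβ n hn h8 => ?_⟩
  -- the reference Gaussian data, by defining equations
  set S : Matrix (Edge 4 L) (Edge 4 L) ℝ := fun e e' => if e.2 = e'.2 then
      Literature.Probability.LatticeModels.torusGreen (e.1 - e'.1) else 0 with hS
  set u : (Fin 4 → ZMod L) → Edge 4 L → ℝ := fun x e =>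
      (if e = (x, (0 : Fin 4)) then (1 : ℝ) else 0)
      + (if e = (x + Pi.single (0 : Fin 4) (1 : ZMod L), (1 : Fin 4)) then 1 else 0)
      - (if e = (x + Pi.single (1 : Fin 4) (1 : ZMod L), (0 : Fin 4)) then 1 else 0)
      - (if e = (x, (1 : Fin 4)) then 1 else 0) with hu
  have hdom := hB β hβ S u rfl rfl n hn h8
  obtain ⟨hpsd, hker⟩ := hF L S u rfl rfl
  have hw := hW (Edge 4 L) S hpsd (u (Pi.single (2 : Fin 4) ((n : ℕ) : ZMod L))) (u 0)
  rw [hw, hker, sub_zero] at hdom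
  -- `κ · 2 · (2K)² = 8κ K²`
  convert hdom using 1
  ring

/-- **GD⁻ from the registered stubs** (reshape c2): `AxisGaussianLower` is no longer a stub but the
glued consequence of W, F and GD-dom. -/
theorem axisGaussianLower_of_stubs : AxisGaussianLower :=
  axisGaussianLower_of_domination stub_wickSquares stub_fieldStrengthCovariance
    stub_axisGaussianDomination

/-- **stub OA** (reshape c1; β-uniform structural; PROVED by the lead and LANDED as
`Theorems/LangevinControlUVFemtoCurvatureTwoPointOffAxis{Engines,Core,Domination}`; reflection-positivity Cauchy–Schwarz for mirror
plaquette pairs, from the landed helpers `…PlaqReflectCauchySchwarz` (general CS incl.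
temporal/shared plaquettes), `…AxisCovNonneg` (translation/permutation transport)): off-axis domination
of every plaquette pair by the two diagonal families along any separating direction `μ`, window
`{m−1, m, m+1}`, `m = |(y−x)_μ|`. Case table (even `L`: link reflection `θt = 1−t` for SS odd `m`,
TT even `m`, ST/TS; site reflection `θ't = −t` for SS even `m`, TT odd `m`, and the `m = 1` mixed cases
with a spatial plaquette IN the reflection hyperplane; odd `L`: the odd-torus reflection with the
complement `L − m` for TT odd `m` and the shared slice `L/2+1` for the `m = 1` mixed case). -/
theorem stub_offAxisDomination :
    ∀ (G : Type) [Group G] [TopologicalSpace G] [IsTopologicalGroup G] [CompactSpace G]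
        [MeasurableSpace G] [BorelSpace G] (N : ℕ) (ρ : G →* Matrix (Fin N) (Fin N) ℂ), Continuous ρ →
      ∀ (L : ℕ) [NeZero L] (β : ℝ), 0 ≤ β →
        ∀ (P : (Fin 4 → ZMod L) → Fin 4 → Fin 4 → GaugeConfig 4 L G → ℝ)
          (E : (GaugeConfig 4 L G → ℝ) → ℝ),
          (P = fun x i j U => (N : ℝ) - (ρ (plaquetteHolonomy U x i j)).trace.re) →
          (E = fun F => wilsonExpectation ρ β F) →
        ∀ (μ : Fin 4) (x y : Fin 4 → ZMod L) (i j i' j' : Fin 4), i ≠ j → i' ≠ j' →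
          1 ≤ ((y μ - x μ).valMinAbs).natAbs →
          (E (fun U => P x i j U * P y i' j' U) - E (P x i j) * E (P y i' j')) ^ 2 ≤
            (∑ s ∈ Finset.range 3,
                |E (fun U => P 0 i j U *
                    P (Pi.single μ ((((y μ - x μ).valMinAbs).natAbs - 1 + s : ℕ) : ZMod L)) i j U)
                  - E (P 0 i j) *
                    E (P (Pi.single μ ((((y μ - x μ).valMinAbs).natAbs - 1 + s : ℕ) : ZMod L)) i j)|) *
            (∑ s ∈ Finset.range 3,
                |E (fun U => P 0 i' j' U *
                    P (Pi.single μ ((((y μ - x μ).valMinAbs).natAbs - 1 + s : ℕ) : ZMod L)) i' j' U)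
                  - E (P 0 i' j') *
                    E (P (Pi.single μ ((((y μ - x μ).valMinAbs).natAbs - 1 + s : ℕ) : ZMod L)) i' j')|) :=
  Summit.QuantumFields.YangMills.Theorems.FemtoCurvatureTwoPoint.stub_offAxisDomination

/-! ### DU₂ reshape (lead c2, second pass): the dyadic variance clause through reflection positivity

`stub_diagUpper` (DU₂) is FACTORED as `diagUpperTwoProfiles_of_parts VAR REST` (glue proved), where
VAR (the variance clause `β² Var P_0^{01} ≤ C` on DYADIC tori `L = 2^(n+1)`) is delivered by an
ALTERNATIVE, reflection-positivity route — chessboard estimate (RPCS ⇒ CHESS) + AM–GM + the moment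
bound `E_β[(βS)^m] ≤ (2m/e)^m Z_L(β/2)/Z_L(β)` + doubling of the fixed-torus partition function (DBL,
from the regular variation RV of `Z_L` — a NAMED FACT: asymptotics of Laplace integrals with analytic
phase, Arnold–Gusein-Zade–Varchenko II Thm 7.6, via resolution of singularities) — and REST is DU₂
with the dyadic variance clause removed (variance on non-dyadic tori + the two profile clauses; the
crux-sized core, unchanged in kind). RPCS, CHESS-of-RPCS, VAR-of-(CHESS, DBL) and DBL-of-RV are
provable now; RV is citable, not provable in the tree (no resolution of singularities); REST and
GD-dom are the core. The chessboard has no odd-`L` version (the antipodal cell straddles the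
reflection plane), which is why REST keeps the non-dyadic variance. -/

/-- **stub RV** (NAMED FACT — Arnold–Gusein-Zade–Varchenko, *Singularities of Differentiable Maps*
Vol. II, Thm. 7.6 with §7.3 (asymptotic series `Σ a_{k,α} τ^α (ln τ)^k` of a Laplace integral with
analytic phase at a minimum, leading coefficient `> 0` for a positive amplitude), globalised over the
compact real-analytic manifold `G^E` by a partition of unity: the fixed-torus Wilson partition function
is regularly varying at `β = ∞`, `Z_L(β) ~ C β^{-λ} (log β)^m`. Not provable in the tree (needs
Hironaka resolution); to be vendored as a Literature `def`. The line is CONDITIONAL on it through VAR. -/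
theorem stub_wilsonPartitionRV :
    ∀ (G : Type) [Group G] [TopologicalSpace G] [IsTopologicalGroup G] [CompactSpace G]
        [MeasurableSpace G] [BorelSpace G] (r : LatticeRep G) (L : ℕ) [NeZero L],
      ∃ (C lam : ℝ) (m : ℕ), 0 < C ∧ 0 ≤ lam ∧
        Tendsto (fun β : ℝ =>
          (partitionFunction (d := 4) (L := L) r.ρ β).toReal * β ^ lam / Real.log β ^ m)
          atTop (nhds C) := by
  sorry

/-- **stub DBL-of-RV** (provable now): regular variation of `Z_L` plus the crude Gaussian lower bound
`Z_L(β) ≥ e^{-48L⁴} C₁^{4L⁴} β^{-2 D L⁴}` (exp chart + Haar small balls, tree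
`exists_exp_chart_range` / `exists_haar_gball_ge`; `D = dim Lie ρ(G)`) give `λ_L ≤ 2 D L⁴`, hence
eventually `Z_L(β/2) ≤ 2^{λ_L+1} Z_L(β) ≤ e^{(2D log 2 + 1) L⁴} Z_L(β)`. -/
theorem stub_doubling_of_RV :
    (∀ (G : Type) [Group G] [TopologicalSpace G] [IsTopologicalGroup G] [CompactSpace G]
          [MeasurableSpace G] [BorelSpace G] (r : LatticeRep G) (L : ℕ) [NeZero L],
        ∃ (C lam : ℝ) (m : ℕ), 0 < C ∧ 0 ≤ lam ∧
          Tendsto (fun β : ℝ =>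
            (partitionFunction (d := 4) (L := L) r.ρ β).toReal * β ^ lam / Real.log β ^ m)
            atTop (nhds C)) →
    ∀ (G : Type) [Group G] [TopologicalSpace G] [IsTopologicalGroup G] [CompactSpace G]
        [MeasurableSpace G] [BorelSpace G] (r : LatticeRep G), ∃ A : ℝ, ∀ (L : ℕ) [NeZero L],
      ∃ B : ℝ, ∀ β : ℝ, B ≤ β →
        (partitionFunction (d := 4) (L := L) r.ρ (β / 2)).toReal ≤
          Real.exp (A * (L : ℝ) ^ 4) * (partitionFunction (d := 4) (L := L) r.ρ β).toReal := by
  sorry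

/-- **stub RPCS** (provable now; reflection positivity of Wilson's measure in all four directions —
site reflections for the in-plane directions `0, 1` (tree `wilsonExpectation_siteReflectionPositive`),
link reflections for the transverse directions `2, 3` (tree `wilsonExpectation_reflectionPositive_holds`),
transported by coordinate permutations and translations; Cauchy–Schwarz for the RP form): for products
of a non-negative bounded function of the `01`-plaquette field over a set `S` of base points,
`ψ(S)² ≤ ψ(symP S) ψ(symM S)` for every block reflection of the abstract chessboard file
(`Literature.Barriers.CriticalPhenomena.NonGibbs.symP/symM`, cells = base points, `N = L` even). -/
theorem stub_plaquetteProductRPCS :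
    ∀ (G : Type) [Group G] [TopologicalSpace G] [IsTopologicalGroup G] [CompactSpace G]
        [MeasurableSpace G] [BorelSpace G] (N : ℕ) (ρ : G →* Matrix (Fin N) (Fin N) ℂ),
      Continuous ρ → (∀ g, ρ g ∈ Matrix.unitaryGroup (Fin N) ℂ) →
      ∀ (L : ℕ) [NeZero L], Even L → ∀ (β : ℝ), 0 ≤ β →
      ∀ (f : ℝ → ℝ), Measurable f → (∀ t, 0 ≤ f t) → (∃ M : ℝ, ∀ t, f t ≤ M) →
      ∀ (ψ : Finset (Fin 4 → ZMod L) → ℝ),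
        (ψ = fun S => wilsonExpectation (d := 4) (L := L) ρ β
          (fun U => ∏ x ∈ S, f ((N : ℝ) - (ρ (plaquetteHolonomy U x 0 1)).trace.re))) →
        ∀ (i : Fin 4) (k : ZMod L) (S : Finset (Fin 4 → ZMod L)),
          ψ S ^ 2 ≤ ψ (symP i k S) * ψ (symM i k S) := by
  sorry

/-- **stub CHESS-of-RPCS** (provable now; Fröhlich–Israel–Lieb–Simon 1978 Thm. 2.2 / Friedli–Velenik
Thm. 10.11 for ONE non-trivial cell: iterate RPCS along doubling runs, the complementary symmetrisation
being empty at each step, so no positivity of `ψ(univ)` is needed; tree `axisRun`/`boxRun` of the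
abstract dyadic chessboard file): the chessboard estimate for the `01`-plaquette field on dyadic tori. -/
theorem stub_chessboard_of_RPCS :
    (∀ (G : Type) [Group G] [TopologicalSpace G] [IsTopologicalGroup G] [CompactSpace G]
          [MeasurableSpace G] [BorelSpace G] (N : ℕ) (ρ : G →* Matrix (Fin N) (Fin N) ℂ),
        Continuous ρ → (∀ g, ρ g ∈ Matrix.unitaryGroup (Fin N) ℂ) →
        ∀ (L : ℕ) [NeZero L], Even L → ∀ (β : ℝ), 0 ≤ β →
        ∀ (f : ℝ → ℝ), Measurable f → (∀ t, 0 ≤ f t) → (∃ M : ℝ, ∀ t, f t ≤ M) →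
        ∀ (ψ : Finset (Fin 4 → ZMod L) → ℝ),
          (ψ = fun S => wilsonExpectation (d := 4) (L := L) ρ β
            (fun U => ∏ x ∈ S, f ((N : ℝ) - (ρ (plaquetteHolonomy U x 0 1)).trace.re))) →
          ∀ (i : Fin 4) (k : ZMod L) (S : Finset (Fin 4 → ZMod L)),
            ψ S ^ 2 ≤ ψ (symP i k S) * ψ (symM i k S)) →
    ∀ (G : Type) [Group G] [TopologicalSpace G] [IsTopologicalGroup G] [CompactSpace G]
        [MeasurableSpace G] [BorelSpace G] (N : ℕ) (ρ : G →* Matrix (Fin N) (Fin N) ℂ),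
      Continuous ρ → (∀ g, ρ g ∈ Matrix.unitaryGroup (Fin N) ℂ) →
      ∀ (n L : ℕ) [NeZero L], L = 2 ^ (n + 1) → ∀ (β : ℝ), 0 ≤ β →
      ∀ (f : ℝ → ℝ), Measurable f → (∀ t, 0 ≤ f t) → (∃ M : ℝ, ∀ t, f t ≤ M) →
        wilsonExpectation (d := 4) (L := L) ρ β
            (fun U => f ((N : ℝ) - (ρ (plaquetteHolonomy U 0 0 1)).trace.re)) ≤
          (wilsonExpectation (d := 4) (L := L) ρ β
            (fun U => ∏ x : Fin 4 → ZMod L, f ((N : ℝ) - (ρ (plaquetteHolonomy U x 0 1)).trace.re)))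
            ^ ((1 : ℝ) / (L : ℝ) ^ 4) := by
  sorry

/-- **stub VAR-of-(CHESS, DBL)** (provable now): `β² Var P_0 ≤ β² E P_0² ≤ β² (E ∏_x P_x²)^{1/L⁴}`
(CHESS with `f = (·)²` on `[0, 2N]`), `∏_x P_x² ≤ (S/L⁴)^{2L⁴}` (AM–GM, `Σ_x P_{x,01} ≤ S`),
`E_β S^m ≤ (2m/(eβ))^m E_β e^{βS/2} = (2m/(eβ))^m Z_L(β/2)/Z_L(β)` (pointwise `s^m e^{-βs/2} ≤ (2m/(eβ))^m`),
so `β² E P_0² ≤ (16/e²) (Z_L(β/2)/Z_L(β))^{1/L⁴} ≤ (16/e²) e^{A}` by DBL. -/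
theorem stub_variance_of_chessboard_doubling :
    (∀ (G : Type) [Group G] [TopologicalSpace G] [IsTopologicalGroup G] [CompactSpace G]
          [MeasurableSpace G] [BorelSpace G] (N : ℕ) (ρ : G →* Matrix (Fin N) (Fin N) ℂ),
        Continuous ρ → (∀ g, ρ g ∈ Matrix.unitaryGroup (Fin N) ℂ) →
        ∀ (n L : ℕ) [NeZero L], L = 2 ^ (n + 1) → ∀ (β : ℝ), 0 ≤ β →
        ∀ (f : ℝ → ℝ), Measurable f → (∀ t, 0 ≤ f t) → (∃ M : ℝ, ∀ t, f t ≤ M) →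
          wilsonExpectation (d := 4) (L := L) ρ β
              (fun U => f ((N : ℝ) - (ρ (plaquetteHolonomy U 0 0 1)).trace.re)) ≤
            (wilsonExpectation (d := 4) (L := L) ρ β
              (fun U => ∏ x : Fin 4 → ZMod L, f ((N : ℝ) - (ρ (plaquetteHolonomy U x 0 1)).trace.re)))
              ^ ((1 : ℝ) / (L : ℝ) ^ 4)) →
    (∀ (G : Type) [Group G] [TopologicalSpace G] [IsTopologicalGroup G] [CompactSpace G]
          [MeasurableSpace G] [BorelSpace G] (r : LatticeRep G), ∃ A : ℝ, ∀ (L : ℕ) [NeZero L],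
        ∃ B : ℝ, ∀ β : ℝ, B ≤ β →
          (partitionFunction (d := 4) (L := L) r.ρ (β / 2)).toReal ≤
            Real.exp (A * (L : ℝ) ^ 4) * (partitionFunction (d := 4) (L := L) r.ρ β).toReal) →
    ∀ (G : Type) [Group G] [TopologicalSpace G] [IsTopologicalGroup G] [CompactSpace G]
        [MeasurableSpace G] [BorelSpace G], IsCompactSimpleLieGroup G →
      ∀ (r : LatticeRep G), ∃ (B : ℕ → ℝ) (C : ℝ),
        ∀ (n L : ℕ) [NeZero L], L = 2 ^ (n + 1) → ∀ (β : ℝ), B L ≤ β →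
        ∀ (P : (Fin 4 → ZMod L) → Fin 4 → Fin 4 → GaugeConfig 4 L G → ℝ)
          (E : (GaugeConfig 4 L G → ℝ) → ℝ),
          (P = fun x i j U => (r.N : ℝ) - (r.ρ (plaquetteHolonomy U x i j)).trace.re) →
          (E = fun F => wilsonExpectation r.ρ β F) →
        β ^ 2 * |E (fun U => P 0 0 1 U * P 0 0 1 U) - E (P 0 0 1) * E (P 0 0 1)| ≤ C := by
  sorry

/-- **stub REST** (HARDEST with GD-dom; the crux-sized remainder of DU₂ — second-order Laplace
asymptotics of Wilson's measure on the fixed torus): the variance clause on NON-dyadic tori and the two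
profile clauses on all tori. -/
theorem stub_diagUpperRest :
    ∀ (G : Type) [Group G] [TopologicalSpace G] [IsTopologicalGroup G] [CompactSpace G]
        [MeasurableSpace G] [BorelSpace G], IsCompactSimpleLieGroup G →
      ∀ (r : LatticeRep G), ∃ (B : ℕ → ℝ) (C : ℝ),
        ∀ (L : ℕ) [NeZero L] (β : ℝ), B L ≤ β →
        ∀ (P : (Fin 4 → ZMod L) → Fin 4 → Fin 4 → GaugeConfig 4 L G → ℝ)
          (E : (GaugeConfig 4 L G → ℝ) → ℝ),
          (P = fun x i j U => (r.N : ℝ) - (r.ρ (plaquetteHolonomy U x i j)).trace.re) →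
          (E = fun F => wilsonExpectation r.ρ β F) →
        ((∀ n : ℕ, L ≠ 2 ^ (n + 1)) →
          β ^ 2 * |E (fun U => P 0 0 1 U * P 0 0 1 U) - E (P 0 0 1) * E (P 0 0 1)| ≤ C) ∧
        ∀ (s : ℕ), 1 ≤ s → s + 1 ≤ L →
          β ^ 2 * (|E (fun U => P 0 0 1 U * P (Pi.single (2 : Fin 4) ((s : ℕ) : ZMod L)) 0 1 U)
              - E (P 0 0 1) * E (P (Pi.single (2 : Fin 4) ((s : ℕ) : ZMod L)) 0 1)|
            * (min (s : ℝ) ((L : ℝ) - s)) ^ 8) ≤ C ∧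
          β ^ 2 * (|E (fun U => P 0 0 1 U * P (Pi.single (0 : Fin 4) ((s : ℕ) : ZMod L)) 0 1 U)
              - E (P 0 0 1) * E (P (Pi.single (0 : Fin 4) ((s : ℕ) : ZMod L)) 0 1)|
            * (min (s : ℝ) ((L : ℝ) - s)) ^ 8) ≤ C := by
  sorry

/-- **Glue VAR ∧ REST ⇒ DU₂ (proved; reshape c2 second pass):** on a dyadic torus the variance clause
comes from VAR, elsewhere from REST; the profiles from REST; thresholds and constants merged by `max`. -/
theorem diagUpperTwoProfiles_of_parts (hV : PlaquetteVarianceDyadic) (hR : DiagUpperRest) :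
    DiagUpperTwoProfiles := by
  intro G _ _ _ _ _ _ hG r
  obtain ⟨B₁, C₁, h₁⟩ := hV G hG r
  obtain ⟨B₂, C₂, h₂⟩ := hR G hG r
  refine ⟨fun L => max (B₁ L) (B₂ L), max C₁ C₂, fun L _ β hβ P E hP hE => ?_⟩
  have hβ₁ : B₁ L ≤ β := (le_max_left _ _).trans hβ
  have hβ₂ : B₂ L ≤ β := (le_max_right _ _).trans hβ
  obtain ⟨hvar, hprof⟩ := h₂ L β hβ₂ P E hP hE
  refine ⟨?_, fun s hs hsL => ?_⟩
  · by_cases hd : ∃ n : ℕ, L = 2 ^ (n + 1)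
    · obtain ⟨n, hn⟩ := hd
      exact (h₁ n L hn β hβ₁ P E hP hE).trans (le_max_left _ _)
    · push Not at hd
      exact (hvar hd).trans (le_max_right _ _)
  · obtain ⟨ha, hb⟩ := hprof s hs hsL
    exact ⟨ha.trans (le_max_right _ _), hb.trans (le_max_right _ _)⟩

/-- **DU₂ from the registered stubs** (reshape c2 second pass): `DiagUpperTwoProfiles` is no longer a
stub but the glued consequence of RPCS, CHESS-of-RPCS, VAR-of-(CHESS, DBL), DBL-of-RV, RV and REST. -/
theorem diagUpperTwoProfiles_of_stubs : DiagUpperTwoProfiles :=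
  diagUpperTwoProfiles_of_parts
    (stub_variance_of_chessboard_doubling (stub_chessboard_of_RPCS stub_plaquetteProductRPCS)
      (stub_doubling_of_RV stub_wilsonPartitionRV))
    stub_diagUpperRest

/-! ## § Reductions (proved): K1a ∧ GD⁻ ⇒ K2⁻ and K1b ∧ GD⁺ ⇒ K2⁺ -/

/-- **K1a ∧ GD⁻ ⇒ K2⁻.** With `c₁ ≤ n⁴ K_L(ne₂)` (kernel band) and `κ K_L(ne₂)² ≤ β² Cov` (Gaussian
domination from below), `κ c₁² ≤ β² n⁸ Cov`: the fixed-torus axis lower bound with `c = κ c₁²` and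
the thresholds of GD⁻. -/
theorem axisLower_of (hK : MaxwellKernelBand) (hGD : AxisGaussianLower) : AxisLowerFixedTorus := by
  intro G _ _ _ _ _ _ hG r
  obtain ⟨c₁, C₁, hc₁, hband⟩ := hK
  obtain ⟨κ, hκ, hL⟩ := hGD G hG r
  classical
  -- per-torus thresholds, by choice (junk `0` at `L = 0`)
  have hB : ∀ L : ℕ, ∃ B : ℝ, ∀ (hL0 : L ≠ 0) (β : ℝ), B ≤ β →
      haveI : NeZero L := ⟨hL0⟩
      ∀ (n : ℕ), 1 ≤ n → 8 * n ≤ L →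
        κ * (((2 * Literature.Probability.LatticeModels.torusGreen
                  (Pi.single (2 : Fin 4) ((n : ℕ) : ZMod L) : Fin 4 → ZMod L)
                - Literature.Probability.LatticeModels.torusGreen
                  ((Pi.single (2 : Fin 4) ((n : ℕ) : ZMod L) : Fin 4 → ZMod L)
                    + Pi.single (0 : Fin 4) (1 : ZMod L))
                - Literature.Probability.LatticeModels.torusGreen
                  ((Pi.single (2 : Fin 4) ((n : ℕ) : ZMod L) : Fin 4 → ZMod L)
                    - Pi.single (0 : Fin 4) (1 : ZMod L)))
              + (2 * Literature.Probability.LatticeModels.torusGreen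
                  (Pi.single (2 : Fin 4) ((n : ℕ) : ZMod L) : Fin 4 → ZMod L)
                - Literature.Probability.LatticeModels.torusGreen
                  ((Pi.single (2 : Fin 4) ((n : ℕ) : ZMod L) : Fin 4 → ZMod L)
                    + Pi.single (1 : Fin 4) (1 : ZMod L))
                - Literature.Probability.LatticeModels.torusGreen
                  ((Pi.single (2 : Fin 4) ((n : ℕ) : ZMod L) : Fin 4 → ZMod L)
                    - Pi.single (1 : Fin 4) (1 : ZMod L)))) / 2) ^ 2
          ≤ β ^ 2 *
            (wilsonExpectation r.ρ β (fun U : GaugeConfig 4 L G =>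
                ((r.N : ℝ) - (r.ρ (plaquetteHolonomy U 0 0 1)).trace.re) *
                  ((r.N : ℝ) - (r.ρ (plaquetteHolonomy U
                    (Pi.single (2 : Fin 4) ((n : ℕ) : ZMod L)) 0 1)).trace.re))
              - wilsonExpectation r.ρ β (fun U : GaugeConfig 4 L G =>
                  (r.N : ℝ) - (r.ρ (plaquetteHolonomy U 0 0 1)).trace.re)
                * wilsonExpectation r.ρ β (fun U : GaugeConfig 4 L G =>
                  (r.N : ℝ) - (r.ρ (plaquetteHolonomy U
                    (Pi.single (2 : Fin 4) ((n : ℕ) : ZMod L)) 0 1)).trace.re)) := by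
    intro L
    by_cases hL0 : L = 0
    · exact ⟨0, fun h => absurd hL0 h⟩
    · haveI : NeZero L := ⟨hL0⟩
      obtain ⟨B, hB⟩ := hL L
      exact ⟨B, fun _ β hβ n hn h8 => hB β hβ n hn h8⟩
  choose B hB using hB
  refine ⟨B, κ * c₁ ^ 2, by positivity, ?_⟩
  intro L _ β hβ P E hP hE n hn h8
  subst hP hE
  have hgd := hB L (NeZero.ne L) β hβ n hn h8
  have hb := (hband L (Pi.single (0 : Fin 4) (1 : ZMod L)) (Pi.single (1 : Fin 4) (1 : ZMod L)) _
    rfl rfl rfl n hn h8).1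
  simp only at hb hgd ⊢
  -- abbreviate kernel and covariance
  set Kn : ℝ := ((2 * Literature.Probability.LatticeModels.torusGreen
                  (Pi.single (2 : Fin 4) ((n : ℕ) : ZMod L) : Fin 4 → ZMod L)
                - Literature.Probability.LatticeModels.torusGreen
                  ((Pi.single (2 : Fin 4) ((n : ℕ) : ZMod L) : Fin 4 → ZMod L)
                    + Pi.single (0 : Fin 4) (1 : ZMod L))
                - Literature.Probability.LatticeModels.torusGreen
                  ((Pi.single (2 : Fin 4) ((n : ℕ) : ZMod L) : Fin 4 → ZMod L)
                    - Pi.single (0 : Fin 4) (1 : ZMod L)))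
              + (2 * Literature.Probability.LatticeModels.torusGreen
                  (Pi.single (2 : Fin 4) ((n : ℕ) : ZMod L) : Fin 4 → ZMod L)
                - Literature.Probability.LatticeModels.torusGreen
                  ((Pi.single (2 : Fin 4) ((n : ℕ) : ZMod L) : Fin 4 → ZMod L)
                    + Pi.single (1 : Fin 4) (1 : ZMod L))
                - Literature.Probability.LatticeModels.torusGreen
                  ((Pi.single (2 : Fin 4) ((n : ℕ) : ZMod L) : Fin 4 → ZMod L)
                    - Pi.single (1 : Fin 4) (1 : ZMod L)))) / 2 with hKn
  set cv : ℝ := wilsonExpectation r.ρ β (fun U : GaugeConfig 4 L G =>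
                ((r.N : ℝ) - (r.ρ (plaquetteHolonomy U 0 0 1)).trace.re) *
                  ((r.N : ℝ) - (r.ρ (plaquetteHolonomy U
                    (Pi.single (2 : Fin 4) ((n : ℕ) : ZMod L)) 0 1)).trace.re))
              - wilsonExpectation r.ρ β (fun U : GaugeConfig 4 L G =>
                  (r.N : ℝ) - (r.ρ (plaquetteHolonomy U 0 0 1)).trace.re)
                * wilsonExpectation r.ρ β (fun U : GaugeConfig 4 L G =>
                  (r.N : ℝ) - (r.ρ (plaquetteHolonomy U
                    (Pi.single (2 : Fin 4) ((n : ℕ) : ZMod L)) 0 1)).trace.re) with hcv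
  -- `c₁ ≤ n⁴ Kn` and `κ Kn² ≤ β² cv`
  have hn4 : (0 : ℝ) ≤ (n : ℝ) ^ 4 := by positivity
  have h1 : c₁ ^ 2 ≤ ((n : ℝ) ^ 4 * Kn) ^ 2 := pow_le_pow_left₀ hc₁.le hb 2
  have h2 : κ * c₁ ^ 2 ≤ (n : ℝ) ^ 8 * (κ * Kn ^ 2) := by
    have : (n : ℝ) ^ 8 * (κ * Kn ^ 2) = κ * ((n : ℝ) ^ 4 * Kn) ^ 2 := by ring
    rw [this]
    exact mul_le_mul_of_nonneg_left h1 hκ.le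
  have h3 : (n : ℝ) ^ 8 * (κ * Kn ^ 2) ≤ (n : ℝ) ^ 8 * (β ^ 2 * cv) :=
    mul_le_mul_of_nonneg_left hgd (by positivity)
  calc κ * c₁ ^ 2 ≤ (n : ℝ) ^ 8 * (β ^ 2 * cv) := h2.trans h3
    _ = β ^ 2 * ((n : ℝ) ^ 8 * cv) := by ring

/-- Torus distance is at most twice the largest coordinate distance. -/
theorem torusDist_le_two_mul_max {L : ℕ} [NeZero L] (x y : Fin 4 → ZMod L) (μ : Fin 4)
    (hμ : ∀ k, ((x k - y k).valMinAbs).natAbs ≤ ((x μ - y μ).valMinAbs).natAbs) :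
    Real.sqrt (∑ k : Fin 4, (((x k - y k).valMinAbs : ℤ) : ℝ) ^ 2) ≤
      2 * (((x μ - y μ).valMinAbs).natAbs : ℝ) := by
  set m : ℕ := ((x μ - y μ).valMinAbs).natAbs with hm
  have hk : ∀ k, (((x k - y k).valMinAbs : ℤ) : ℝ) ^ 2 ≤ (m : ℝ) ^ 2 := fun k => by
    have h1 : |(((x k - y k).valMinAbs : ℤ) : ℝ)| = (((x k - y k).valMinAbs.natAbs : ℕ) : ℝ) := by
      rw [← Int.cast_abs, Int.abs_eq_natAbs, Int.cast_natCast]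
    have h2 : (((x k - y k).valMinAbs.natAbs : ℕ) : ℝ) ≤ m := by exact_mod_cast hμ k
    calc (((x k - y k).valMinAbs : ℤ) : ℝ) ^ 2 = |(((x k - y k).valMinAbs : ℤ) : ℝ)| ^ 2 :=
          (sq_abs _).symm
      _ ≤ (m : ℝ) ^ 2 := by rw [h1]; exact pow_le_pow_left₀ (Nat.cast_nonneg _) h2 2
  rw [Real.sqrt_le_iff]
  refine ⟨by positivity, ?_⟩
  calc ∑ k : Fin 4, (((x k - y k).valMinAbs : ℤ) : ℝ) ^ 2 ≤ ∑ _k : Fin 4, (m : ℝ) ^ 2 :=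
        Finset.sum_le_sum fun k _ => hk k
    _ = (2 * (m : ℝ)) ^ 2 := by simp; ring

/-- **OA ∧ DU ⇒ K2⁺** (the reshaped reduction of the all-pairs fixed-torus upper bound to the diagonal
families): pick the coordinate `μ` of largest torus distance `m ≥ dist/2`, dominate `Cov²` by the two
window sums of diagonal covariances (OA), bound every window term by `C β⁻² max(m−1,1)⁻⁸` (DU; the
index `0 (mod L)` is a variance), and use `dist⁸ ≤ 2⁸ m⁸ ≤ 2¹⁶ max(m−1,1)⁸`. -/
theorem pairUpper_of' (hOA : OffAxisDomination) (hDU : DiagUpperFixedTorus) :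
    PairUpperFixedTorus := by
  intro G _ _ _ _ _ _ hG r
  obtain ⟨B, C, hB⟩ := hDU G hG r
  refine ⟨fun L => max (B L) 0, 196608 * max C 0, ?_⟩
  intro L _ β hβ P E hP hE x y i j i' j' hxy hij hij'
  have hβB : B L ≤ β := (le_max_left _ _).trans hβ
  have hβ0 : 0 ≤ β := (le_max_right _ _).trans hβ
  obtain ⟨hVar, hDiag⟩ := hB L β hβB P E hP hE
  set C' : ℝ := max C 0 with hC'
  have hC'0 : 0 ≤ C' := le_max_right _ _
  have hCC' : C ≤ C' := le_max_left _ _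
  -- the coordinate of largest torus distance
  obtain ⟨μ, -, hμ⟩ := Finset.exists_max_image Finset.univ
    (fun k : Fin 4 => ((x k - y k).valMinAbs).natAbs) Finset.univ_nonempty
  set m : ℕ := ((x μ - y μ).valMinAbs).natAbs with hm
  have hμ' : ∀ k, ((x k - y k).valMinAbs).natAbs ≤ m := fun k => hμ k (Finset.mem_univ k)
  have hm1 : 1 ≤ m := by
    obtain ⟨k, hk⟩ : ∃ k, x k ≠ y k := by
      by_contra h
      push Not at h
      exact hxy (funext h)
    have : ((x k - y k).valMinAbs).natAbs ≠ 0 := by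
      rw [Ne, Int.natAbs_eq_zero, ZMod.valMinAbs_eq_zero]
      exact sub_ne_zero.2 hk
    have := hμ' k
    omega
  have hmL : 2 * m ≤ L := by
    have h := ZMod.natAbs_valMinAbs_le (x μ - y μ)
    omega
  have hmyx : ((y μ - x μ).valMinAbs).natAbs = m := by
    rw [← neg_sub, ZMod.natAbs_valMinAbs_neg]
  -- the distance
  set d : ℝ := Real.sqrt (∑ k : Fin 4, (((x k - y k).valMinAbs : ℤ) : ℝ) ^ 2) with hd
  have hd0 : 0 ≤ d := Real.sqrt_nonneg _
  have hd2m : d ≤ 2 * (m : ℝ) := torusDist_le_two_mul_max x y μ hμ'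
  -- the covariance
  set cv : ℝ := E (fun U => P x i j U * P y i' j' U) - E (P x i j) * E (P y i' j') with hcv
  -- trivial when `β = 0`
  rcases hβ0.eq_or_lt with hβz | hβpos
  · rw [← hβz]
    have : (0 : ℝ) ^ 2 * (|cv| * d ^ 8) = 0 := by ring
    rw [this]
    positivity
  -- window bound: every `|D(n)|` with `n ∈ {m-1, m, m+1}` is `≤ C'/(β² k⁸)`, `k = max (m-1) 1`
  set k : ℕ := max (m - 1) 1 with hk
  have hk1 : 1 ≤ k := le_max_right _ _
  have hkpos : (0 : ℝ) < k := by exact_mod_cast hk1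
  have hβ2 : 0 < β ^ 2 := by positivity
  have hterm : ∀ (a b : Fin 4), a ≠ b → ∀ s ∈ Finset.range 3,
      |E (fun U => P 0 a b U * P (Pi.single μ (((m - 1 + s : ℕ) : ℕ) : ZMod L)) a b U)
          - E (P 0 a b) * E (P (Pi.single μ (((m - 1 + s : ℕ) : ℕ) : ZMod L)) a b)|
        ≤ C' / (β ^ 2 * (k : ℝ) ^ 8) := by
    intro a b hab s hs
    have hs3 : s < 3 := Finset.mem_range.1 hs
    set n : ℕ := m - 1 + s with hn
    rw [le_div_iff₀ (by positivity)]
    by_cases hn0 : n = 0 ∨ n = L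
    · -- variance term
      have hcast : ((n : ℕ) : ZMod L) = 0 := by
        rcases hn0 with h | h
        · rw [h, Nat.cast_zero]
        · rw [h, ZMod.natCast_self]
      have hk1' : k = 1 := by
        rcases hn0 with h | h <;> simp only [hk] <;> omega
      rw [hcast, Pi.single_zero, hk1', Nat.cast_one, one_pow, mul_one]
      calc |E (fun U => P 0 a b U * P 0 a b U) - E (P 0 a b) * E (P 0 a b)| * β ^ 2
          = β ^ 2 * |E (fun U => P 0 a b U * P 0 a b U) - E (P 0 a b) * E (P 0 a b)| := by ring
        _ ≤ C := hVar a b hab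
        _ ≤ C' := hCC'
    · push Not at hn0
      have hn1 : 1 ≤ n := by omega
      have hnL : n + 1 ≤ L := by omega
      have h := hDiag a b μ n hab hn1 hnL
      -- `min n (L - n) ≥ k`
      have hmin : (k : ℝ) ≤ min (n : ℝ) ((L : ℝ) - n) := by
        rw [le_min_iff]
        constructor
        · exact_mod_cast (show k ≤ n by simp only [hk]; omega)
        · have : k + n ≤ L := by simp only [hk]; omega
          have : ((k + n : ℕ) : ℝ) ≤ L := by exact_mod_cast this
          push_cast at this
          linarith
      have hmin0 : (0 : ℝ) ≤ min (n : ℝ) ((L : ℝ) - n) := hkpos.le.trans hmin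
      set t := |E (fun U => P 0 a b U * P (Pi.single μ (((n : ℕ) : ℕ) : ZMod L)) a b U)
          - E (P 0 a b) * E (P (Pi.single μ (((n : ℕ) : ℕ) : ZMod L)) a b)| with ht
      have ht0 : 0 ≤ t := abs_nonneg _
      have h1 : t * (β ^ 2 * (k : ℝ) ^ 8) ≤ t * (β ^ 2 * (min (n : ℝ) ((L : ℝ) - n)) ^ 8) :=
        mul_le_mul_of_nonneg_left (mul_le_mul_of_nonneg_left
          (pow_le_pow_left₀ hkpos.le hmin 8) hβ2.le) ht0
      calc t * (β ^ 2 * (k : ℝ) ^ 8) ≤ t * (β ^ 2 * (min (n : ℝ) ((L : ℝ) - n)) ^ 8) := h1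
        _ = β ^ 2 * (t * (min (n : ℝ) ((L : ℝ) - n)) ^ 8) := by ring
        _ ≤ C := h
        _ ≤ C' := hCC'
  -- off-axis domination
  have hOA' := hOA G r.N r.ρ r.continuous L β hβ0 P E hP hE μ x y i j i' j' hij hij'
    (by rw [hmyx]; exact hm1)
  rw [hmyx] at hOA'
  have hS : ∀ (a b : Fin 4), a ≠ b →
      (∑ s ∈ Finset.range 3,
        |E (fun U => P 0 a b U * P (Pi.single μ (((m - 1 + s : ℕ) : ℕ) : ZMod L)) a b U)
          - E (P 0 a b) * E (P (Pi.single μ (((m - 1 + s : ℕ) : ℕ) : ZMod L)) a b)|)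
        ≤ 3 * (C' / (β ^ 2 * (k : ℝ) ^ 8)) := fun a b hab => by
    calc (∑ s ∈ Finset.range 3,
          |E (fun U => P 0 a b U * P (Pi.single μ (((m - 1 + s : ℕ) : ℕ) : ZMod L)) a b U)
            - E (P 0 a b) * E (P (Pi.single μ (((m - 1 + s : ℕ) : ℕ) : ZMod L)) a b)|)
        ≤ ∑ _s ∈ Finset.range 3, C' / (β ^ 2 * (k : ℝ) ^ 8) :=
          Finset.sum_le_sum fun s hs => hterm a b hab s hs
      _ = 3 * (C' / (β ^ 2 * (k : ℝ) ^ 8)) := by simp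
  set w : ℝ := C' / (β ^ 2 * (k : ℝ) ^ 8) with hw
  have hw0 : 0 ≤ w := by positivity
  have hsq : cv ^ 2 ≤ (3 * w) * (3 * w) := by
    refine hOA'.trans ?_
    have h1 := hS i j hij
    have h2 := hS i' j' hij'
    have h10 : 0 ≤ ∑ s ∈ Finset.range 3,
        |E (fun U => P 0 i j U * P (Pi.single μ (((m - 1 + s : ℕ) : ℕ) : ZMod L)) i j U)
          - E (P 0 i j) * E (P (Pi.single μ (((m - 1 + s : ℕ) : ℕ) : ZMod L)) i j)| :=
      Finset.sum_nonneg fun _ _ => abs_nonneg _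
    exact mul_le_mul h1 h2 (Finset.sum_nonneg fun _ _ => abs_nonneg _) (by positivity)
  have h9 : cv ^ 2 ≤ (3 * w) ^ 2 := by nlinarith [hsq]
  have habs : |cv| ≤ 3 * w := abs_le_of_sq_le_sq h9 (by positivity)
  -- assemble: `β² |cv| d⁸ ≤ β² · 3w · (2m)⁸ = 3 C' (2m/k)⁸ ≤ 3 C' 4⁸`
  have hmk : (m : ℝ) ≤ 2 * k := by
    have : m ≤ 2 * k := by simp only [hk]; omega
    exact_mod_cast this
  have hd8 : d ^ 8 ≤ (4 * (k : ℝ)) ^ 8 :=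
    pow_le_pow_left₀ hd0 (hd2m.trans (by linarith)) 8
  calc β ^ 2 * (|cv| * d ^ 8) ≤ β ^ 2 * ((3 * w) * (4 * (k : ℝ)) ^ 8) := by
        refine mul_le_mul_of_nonneg_left ?_ hβ2.le
        exact mul_le_mul habs hd8 (by positivity) (by positivity)
    _ = 196608 * C' := by
        simp only [hw]
        field_simp
        ring

/-! ## § Handles — the registered types are the readable statements -/

theorem maxwellKernelBand_iff : MaxwellKernelBand ↔
    ∃ (c C : ℝ), 0 < c ∧ ∀ (L : ℕ) [NeZero L] (e₀ e₁ : Fin 4 → ZMod L) (K : (Fin 4 → ZMod L) → ℝ),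
      e₀ = Pi.single (0 : Fin 4) (1 : ZMod L) → e₁ = Pi.single (1 : Fin 4) (1 : ZMod L) →
      (K = fun z =>
        ((2 * Literature.Probability.LatticeModels.torusGreen z
            - Literature.Probability.LatticeModels.torusGreen (z + e₀)
            - Literature.Probability.LatticeModels.torusGreen (z - e₀))
          + (2 * Literature.Probability.LatticeModels.torusGreen z
            - Literature.Probability.LatticeModels.torusGreen (z + e₁)
            - Literature.Probability.LatticeModels.torusGreen (z - e₁))) / 2) →
      ∀ (n : ℕ), 1 ≤ n → 8 * n ≤ L →
        c ≤ (n : ℝ) ^ 4 * K (Pi.single (2 : Fin 4) ((n : ℕ) : ZMod L)) ∧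
          (n : ℝ) ^ 4 * K (Pi.single (2 : Fin 4) ((n : ℕ) : ZMod L)) ≤ C := Iff.rfl

theorem axisLowerFixedTorus_iff : AxisLowerFixedTorus ↔
    ∀ (G : Type) [Group G] [TopologicalSpace G] [IsTopologicalGroup G] [CompactSpace G]
      [MeasurableSpace G] [BorelSpace G], IsCompactSimpleLieGroup G →
    ∀ (r : LatticeRep G), ∃ (B : ℕ → ℝ) (c : ℝ), 0 < c ∧
      ∀ (L : ℕ) [NeZero L] (β : ℝ), B L ≤ β →
      ∀ (P : (Fin 4 → ZMod L) → Fin 4 → Fin 4 → GaugeConfig 4 L G → ℝ)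
        (E : (GaugeConfig 4 L G → ℝ) → ℝ),
        (P = fun x i j U => (r.N : ℝ) - (r.ρ (plaquetteHolonomy U x i j)).trace.re) →
        (E = fun F => wilsonExpectation r.ρ β F) →
      ∀ (n : ℕ), 1 ≤ n → 8 * n ≤ L →
        c ≤ β ^ 2 * ((n : ℝ) ^ 8 *
          (E (fun U => P 0 0 1 U * P (Pi.single (2 : Fin 4) ((n : ℕ) : ZMod L)) 0 1 U) -
            E (P 0 0 1) * E (P (Pi.single (2 : Fin 4) ((n : ℕ) : ZMod L)) 0 1))) := Iff.rfl

theorem pairUpperFixedTorus_iff : PairUpperFixedTorus ↔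
    ∀ (G : Type) [Group G] [TopologicalSpace G] [IsTopologicalGroup G] [CompactSpace G]
      [MeasurableSpace G] [BorelSpace G], IsCompactSimpleLieGroup G →
    ∀ (r : LatticeRep G), ∃ (B : ℕ → ℝ) (C : ℝ),
      ∀ (L : ℕ) [NeZero L] (β : ℝ), B L ≤ β →
      ∀ (P : (Fin 4 → ZMod L) → Fin 4 → Fin 4 → GaugeConfig 4 L G → ℝ)
        (E : (GaugeConfig 4 L G → ℝ) → ℝ),
        (P = fun x i j U => (r.N : ℝ) - (r.ρ (plaquetteHolonomy U x i j)).trace.re) →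
        (E = fun F => wilsonExpectation r.ρ β F) →
      ∀ (x y : Fin 4 → ZMod L) (i j i' j' : Fin 4), x ≠ y → i ≠ j → i' ≠ j' →
        β ^ 2 * (|E (fun U => P x i j U * P y i' j' U) - E (P x i j) * E (P y i' j')|
          * Real.sqrt (∑ k : Fin 4, (((x k - y k).valMinAbs : ℤ) : ℝ) ^ 2) ^ 8) ≤ C := Iff.rfl

theorem axisGaussianLower_iff : AxisGaussianLower ↔
    ∀ (G : Type) [Group G] [TopologicalSpace G] [IsTopologicalGroup G] [CompactSpace G]
      [MeasurableSpace G] [BorelSpace G], IsCompactSimpleLieGroup G →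
    ∀ (r : LatticeRep G), ∃ κ : ℝ, 0 < κ ∧ ∀ (L : ℕ) [NeZero L], ∃ B : ℝ, ∀ (β : ℝ), B ≤ β →
      ∀ (n : ℕ), 1 ≤ n → 8 * n ≤ L →
        κ * (((2 * Literature.Probability.LatticeModels.torusGreen
                  (Pi.single (2 : Fin 4) ((n : ℕ) : ZMod L) : Fin 4 → ZMod L)
                - Literature.Probability.LatticeModels.torusGreen
                  ((Pi.single (2 : Fin 4) ((n : ℕ) : ZMod L) : Fin 4 → ZMod L)
                    + Pi.single (0 : Fin 4) (1 : ZMod L))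
                - Literature.Probability.LatticeModels.torusGreen
                  ((Pi.single (2 : Fin 4) ((n : ℕ) : ZMod L) : Fin 4 → ZMod L)
                    - Pi.single (0 : Fin 4) (1 : ZMod L)))
              + (2 * Literature.Probability.LatticeModels.torusGreen
                  (Pi.single (2 : Fin 4) ((n : ℕ) : ZMod L) : Fin 4 → ZMod L)
                - Literature.Probability.LatticeModels.torusGreen
                  ((Pi.single (2 : Fin 4) ((n : ℕ) : ZMod L) : Fin 4 → ZMod L)
                    + Pi.single (1 : Fin 4) (1 : ZMod L))
                - Literature.Probability.LatticeModels.torusGreen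
                  ((Pi.single (2 : Fin 4) ((n : ℕ) : ZMod L) : Fin 4 → ZMod L)
                    - Pi.single (1 : Fin 4) (1 : ZMod L)))) / 2) ^ 2
          ≤ β ^ 2 *
            (wilsonExpectation r.ρ β (fun U : GaugeConfig 4 L G =>
                ((r.N : ℝ) - (r.ρ (plaquetteHolonomy U 0 0 1)).trace.re) *
                  ((r.N : ℝ) - (r.ρ (plaquetteHolonomy U
                    (Pi.single (2 : Fin 4) ((n : ℕ) : ZMod L)) 0 1)).trace.re))
              - wilsonExpectation r.ρ β (fun U : GaugeConfig 4 L G =>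
                  (r.N : ℝ) - (r.ρ (plaquetteHolonomy U 0 0 1)).trace.re)
                * wilsonExpectation r.ρ β (fun U : GaugeConfig 4 L G =>
                  (r.N : ℝ) - (r.ρ (plaquetteHolonomy U
                    (Pi.single (2 : Fin 4) ((n : ℕ) : ZMod L)) 0 1)).trace.re)) := Iff.rfl

theorem offAxisDomination_iff : OffAxisDomination ↔
    ∀ (G : Type) [Group G] [TopologicalSpace G] [IsTopologicalGroup G] [CompactSpace G]
        [MeasurableSpace G] [BorelSpace G] (N : ℕ) (ρ : G →* Matrix (Fin N) (Fin N) ℂ), Continuous ρ →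
      ∀ (L : ℕ) [NeZero L] (β : ℝ), 0 ≤ β →
        ∀ (P : (Fin 4 → ZMod L) → Fin 4 → Fin 4 → GaugeConfig 4 L G → ℝ)
          (E : (GaugeConfig 4 L G → ℝ) → ℝ),
          (P = fun x i j U => (N : ℝ) - (ρ (plaquetteHolonomy U x i j)).trace.re) →
          (E = fun F => wilsonExpectation ρ β F) →
        ∀ (μ : Fin 4) (x y : Fin 4 → ZMod L) (i j i' j' : Fin 4), i ≠ j → i' ≠ j' →
          1 ≤ ((y μ - x μ).valMinAbs).natAbs →
          (E (fun U => P x i j U * P y i' j' U) - E (P x i j) * E (P y i' j')) ^ 2 ≤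
            (∑ s ∈ Finset.range 3,
                |E (fun U => P 0 i j U *
                    P (Pi.single μ ((((y μ - x μ).valMinAbs).natAbs - 1 + s : ℕ) : ZMod L)) i j U)
                  - E (P 0 i j) *
                    E (P (Pi.single μ ((((y μ - x μ).valMinAbs).natAbs - 1 + s : ℕ) : ZMod L)) i j)|) *
            (∑ s ∈ Finset.range 3,
                |E (fun U => P 0 i' j' U *
                    P (Pi.single μ ((((y μ - x μ).valMinAbs).natAbs - 1 + s : ℕ) : ZMod L)) i' j' U)
                  - E (P 0 i' j') *
                    E (P (Pi.single μ ((((y μ - x μ).valMinAbs).natAbs - 1 + s : ℕ) : ZMod L)) i' j')|) := Iff.rfl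

theorem diagUpperFixedTorus_iff : DiagUpperFixedTorus ↔
    ∀ (G : Type) [Group G] [TopologicalSpace G] [IsTopologicalGroup G] [CompactSpace G]
        [MeasurableSpace G] [BorelSpace G], IsCompactSimpleLieGroup G →
      ∀ (r : LatticeRep G), ∃ (B : ℕ → ℝ) (C : ℝ),
        ∀ (L : ℕ) [NeZero L] (β : ℝ), B L ≤ β →
        ∀ (P : (Fin 4 → ZMod L) → Fin 4 → Fin 4 → GaugeConfig 4 L G → ℝ)
          (E : (GaugeConfig 4 L G → ℝ) → ℝ),
          (P = fun x i j U => (r.N : ℝ) - (r.ρ (plaquetteHolonomy U x i j)).trace.re) →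
          (E = fun F => wilsonExpectation r.ρ β F) →
        (∀ (i j : Fin 4), i ≠ j →
            β ^ 2 * |E (fun U => P 0 i j U * P 0 i j U) - E (P 0 i j) * E (P 0 i j)| ≤ C) ∧
        (∀ (i j μ : Fin 4) (s : ℕ), i ≠ j → 1 ≤ s → s + 1 ≤ L →
            β ^ 2 * (|E (fun U => P 0 i j U * P (Pi.single μ ((s : ℕ) : ZMod L)) i j U)
                - E (P 0 i j) * E (P (Pi.single μ ((s : ℕ) : ZMod L)) i j)|
              * (min (s : ℝ) ((L : ℝ) - s)) ^ 8) ≤ C) := Iff.rfl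

theorem diagUpperTwoProfiles_iff : DiagUpperTwoProfiles ↔
    ∀ (G : Type) [Group G] [TopologicalSpace G] [IsTopologicalGroup G] [CompactSpace G]
        [MeasurableSpace G] [BorelSpace G], IsCompactSimpleLieGroup G →
      ∀ (r : LatticeRep G), ∃ (B : ℕ → ℝ) (C : ℝ),
        ∀ (L : ℕ) [NeZero L] (β : ℝ), B L ≤ β →
        ∀ (P : (Fin 4 → ZMod L) → Fin 4 → Fin 4 → GaugeConfig 4 L G → ℝ)
          (E : (GaugeConfig 4 L G → ℝ) → ℝ),
          (P = fun x i j U => (r.N : ℝ) - (r.ρ (plaquetteHolonomy U x i j)).trace.re) →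
          (E = fun F => wilsonExpectation r.ρ β F) →
        β ^ 2 * |E (fun U => P 0 0 1 U * P 0 0 1 U) - E (P 0 0 1) * E (P 0 0 1)| ≤ C ∧
        ∀ (s : ℕ), 1 ≤ s → s + 1 ≤ L →
          β ^ 2 * (|E (fun U => P 0 0 1 U * P (Pi.single (2 : Fin 4) ((s : ℕ) : ZMod L)) 0 1 U)
              - E (P 0 0 1) * E (P (Pi.single (2 : Fin 4) ((s : ℕ) : ZMod L)) 0 1)|
            * (min (s : ℝ) ((L : ℝ) - s)) ^ 8) ≤ C ∧
          β ^ 2 * (|E (fun U => P 0 0 1 U * P (Pi.single (0 : Fin 4) ((s : ℕ) : ZMod L)) 0 1 U)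
              - E (P 0 0 1) * E (P (Pi.single (0 : Fin 4) ((s : ℕ) : ZMod L)) 0 1)|
            * (min (s : ℝ) ((L : ℝ) - s)) ^ 8) ≤ C := Iff.rfl

/-! ## § Torus-distance bookkeeping -/

/-- Torus distances between distinct sites are square roots of positive integers. -/
theorem dist_eq_sqrt_nat {L : ℕ} (x y : Fin 4 → ZMod L) (hxy : x ≠ y) :
    ∃ m : ℕ, 1 ≤ m ∧
      Real.sqrt (∑ k : Fin 4, (((x k - y k).valMinAbs : ℤ) : ℝ) ^ 2) = Real.sqrt (m : ℝ) := by
  refine ⟨∑ k : Fin 4, ((x k - y k).valMinAbs.natAbs) ^ 2, ?_, ?_⟩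
  · obtain ⟨k, hk⟩ := Function.ne_iff.1 hxy
    have hne : (x k - y k).valMinAbs ≠ 0 := by
      rw [Ne, ZMod.valMinAbs_eq_zero, sub_eq_zero]; exact hk
    have h1 : 1 ≤ (x k - y k).valMinAbs.natAbs ^ 2 := by
      have : 1 ≤ (x k - y k).valMinAbs.natAbs := Nat.one_le_iff_ne_zero.2 (Int.natAbs_ne_zero.2 hne)
      nlinarith
    exact h1.trans (Finset.single_le_sum (f := fun i => ((x i - y i).valMinAbs.natAbs) ^ 2)
      (fun i _ => Nat.zero_le _) (Finset.mem_univ k))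
  · congr 1
    push_cast
    refine Finset.sum_congr rfl fun k _ => ?_
    rw [Nat.cast_natAbs, Int.cast_abs, sq_abs]

/-- The axis site `n e₂` is not the origin for `1 ≤ n`, `8n ≤ L`. -/
theorem axis_ne {L n : ℕ} (hn : 1 ≤ n) (h8 : 8 * n ≤ L) :
    (0 : Fin 4 → ZMod L) ≠ Pi.single (2 : Fin 4) ((n : ℕ) : ZMod L) := by
  intro h
  have h2 := congr_fun h (2 : Fin 4)
  simp only [Pi.zero_apply, Pi.single_eq_same] at h2
  have hdvd : L ∣ n := (ZMod.natCast_eq_zero_iff n L).1 h2.symm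
  have hL : L ≤ n := Nat.le_of_dvd (by omega) hdvd
  omega

/-- The torus distance from the origin to `n e₂` is `n` (`8n ≤ L`). -/
theorem dist_axis {L n : ℕ} [NeZero L] (hn : 1 ≤ n) (h8 : 8 * n ≤ L) :
    Real.sqrt (∑ k : Fin 4,
      ((((0 : Fin 4 → ZMod L) k -
        (Pi.single (2 : Fin 4) ((n : ℕ) : ZMod L) : Fin 4 → ZMod L) k).valMinAbs : ℤ) : ℝ) ^ 2)
      = n := by
  set y : Fin 4 → ZMod L := Pi.single (2 : Fin 4) ((n : ℕ) : ZMod L) with hy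
  have hval : ((n : ℕ) : ZMod L).val = n := ZMod.val_natCast_of_lt (by omega)
  have hhalf : ((n : ℕ) : ZMod L).valMinAbs = n := ZMod.valMinAbs_natCast_of_le_half (by omega)
  have hneg : (-((n : ℕ) : ZMod L)).valMinAbs = -(n : ℤ) := by
    rw [ZMod.valMinAbs_neg_of_ne_half, hhalf]
    rw [hval]; omega
  have h0 : y 0 = 0 := by simp [hy]
  have h1 : y 1 = 0 := by simp [hy]
  have h2 : y 2 = ((n : ℕ) : ZMod L) := by simp [hy]
  have h3 : y 3 = 0 := by simp [hy]
  have hsum : ∑ k : Fin 4, ((((0 : Fin 4 → ZMod L) k - y k).valMinAbs : ℤ) : ℝ) ^ 2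
      = (n : ℝ) ^ 2 := by
    simp only [Fin.sum_univ_four, Pi.zero_apply, zero_sub, h0, h1, h2, h3, neg_zero,
      ZMod.valMinAbs_zero, hneg]
    push_cast
    ring
  rw [hsum, Real.sqrt_sq (Nat.cast_nonneg n)]

/-! ## § Merging the two analytic stubs into C⁺ -/

/-- `K2⁻ ∧ K2⁺ ⇒ C⁺`: instantiate the Borel structure, discharge the defining equations by `rfl`,
merge the thresholds; the axis upper bound is the pair bound at `(0, n e₂)`, where `dist = n`. -/
theorem fixedTorusTwoSided_of : AxisLowerFixedTorus → PairUpperFixedTorus → FixedTorusTwoSided := by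
  intro hA hU G _ _ _ _ hG
  letI : MeasurableSpace G := borel G
  haveI : BorelSpace G := ⟨rfl⟩
  intro r
  obtain ⟨B₁, c, hc, HA⟩ := hA G hG r
  obtain ⟨B₂, C, HU⟩ := hU G hG r
  refine ⟨fun L => max (B₁ L) (B₂ L), c, |C|, hc, ?_⟩
  intro L _ β hβ
  have hA' := HA L β ((le_max_left _ _).trans hβ) _ _ rfl rfl
  have hU' := HU L β ((le_max_right _ _).trans hβ) _ _ rfl rfl
  refine ⟨fun n hn h8 => ⟨hA' n hn h8, ?_⟩,
    fun x y i j i' j' hxy hij hij' => (hU' x y i j i' j' hxy hij hij').trans (le_abs_self C)⟩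
  have h01 : (0 : Fin 4) ≠ 1 := by decide
  have h := hU' 0 (Pi.single (2 : Fin 4) ((n : ℕ) : ZMod L)) 0 1 0 1 (axis_ne hn h8) h01 h01
  have key : ∀ (Y D : ℝ), D = n → β ^ 2 * (|Y| * D ^ 8) ≤ C → β ^ 2 * ((n : ℝ) ^ 8 * Y) ≤ |C| := by
    intro Y D hD hY
    subst hD
    have h1 : (n : ℝ) ^ 8 * Y ≤ |Y| * (n : ℝ) ^ 8 := by
      rw [mul_comm]; exact mul_le_mul_of_nonneg_right (le_abs_self Y) (by positivity)
    have h2 : β ^ 2 * ((n : ℝ) ^ 8 * Y) ≤ β ^ 2 * (|Y| * (n : ℝ) ^ 8) :=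
      mul_le_mul_of_nonneg_left h1 (sq_nonneg β)
    exact h2.trans (hY.trans (le_abs_self C))
  exact key _ _ (dist_axis (L := L) hn h8) h

/-! ## § The generic-step encoding (proved): `C⁺ ⇒ crux`

### Step index `k(β)` with `2^k ≤ β < 2^{k+1}` (as in `Ideator2.crux_of_deepBand`) -/

/-- Step index `k(β) = ⌊log₂ ⌊β⌋₊⌋`. -/
def stepIdx (β : ℝ) : ℕ := Nat.log 2 ⌊β⌋₊

theorem two_pow_stepIdx_le {β : ℝ} (hβ : 1 ≤ β) : (2 : ℝ) ^ stepIdx β ≤ β := by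
  have hfl : ⌊β⌋₊ ≠ 0 := (Nat.floor_pos.2 hβ).ne'
  have h1 : 2 ^ Nat.log 2 ⌊β⌋₊ ≤ ⌊β⌋₊ := Nat.pow_log_le_self 2 hfl
  have h2 : ((2 ^ Nat.log 2 ⌊β⌋₊ : ℕ) : ℝ) ≤ (⌊β⌋₊ : ℝ) := by exact_mod_cast h1
  have h3 : (⌊β⌋₊ : ℝ) ≤ β := Nat.floor_le (by linarith)
  have h4 : ((2 ^ Nat.log 2 ⌊β⌋₊ : ℕ) : ℝ) = (2 : ℝ) ^ stepIdx β := by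
    rw [stepIdx]; push_cast; ring
  rw [← h4]
  exact h2.trans h3

theorem lt_two_pow_stepIdx_succ (β : ℝ) : β < (2 : ℝ) ^ (stepIdx β + 1) := by
  have h1 : ⌊β⌋₊ < 2 ^ (Nat.log 2 ⌊β⌋₊ + 1) := Nat.lt_pow_succ_log_self (by norm_num) ⌊β⌋₊
  have h2 : ⌊β⌋₊ + 1 ≤ 2 ^ (Nat.log 2 ⌊β⌋₊ + 1) := h1
  have h3 : ((⌊β⌋₊ + 1 : ℕ) : ℝ) ≤ ((2 ^ (Nat.log 2 ⌊β⌋₊ + 1) : ℕ) : ℝ) := by exact_mod_cast h2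
  have h4 : β < (⌊β⌋₊ : ℝ) + 1 := Nat.lt_floor_add_one β
  calc β < (⌊β⌋₊ : ℝ) + 1 := h4
    _ = ((⌊β⌋₊ + 1 : ℕ) : ℝ) := by push_cast; ring
    _ ≤ ((2 ^ (Nat.log 2 ⌊β⌋₊ + 1) : ℕ) : ℝ) := h3
    _ = (2 : ℝ) ^ (stepIdx β + 1) := by rw [stepIdx]; push_cast; ring

/-- `2^K ≤ β ⇒ K ≤ k(β)`: the step index is unbounded along `β → ∞`. -/
theorem le_stepIdx_of_le {K : ℕ} {β : ℝ} (h : (2 : ℝ) ^ K ≤ β) : K ≤ stepIdx β := by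
  have h0 : (0 : ℝ) ≤ β := le_trans (by positivity) h
  have h1 : (2 : ℕ) ^ K ≤ ⌊β⌋₊ := by
    refine Nat.le_floor ?_
    push_cast
    exact h
  unfold stepIdx
  exact Nat.le_log_of_pow_le (by norm_num) h1

/-! ### The threshold ladder -/

/-- Monotone envelope of a threshold function: `T(L) = L + Σ_{i ≤ L} |B i|`. -/
def env (B : ℕ → ℝ) (L : ℕ) : ℝ := (L : ℝ) + ∑ i ∈ Finset.range (L + 1), |B i|

theorem le_env (B : ℕ → ℝ) (L : ℕ) : (L : ℝ) ≤ env B L := by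
  have := Finset.sum_nonneg fun i (_ : i ∈ Finset.range (L + 1)) => abs_nonneg (B i)
  simp only [env]; linarith

theorem self_le_env (B : ℕ → ℝ) (L : ℕ) : B L ≤ env B L := by
  have h1 : |B L| ≤ ∑ i ∈ Finset.range (L + 1), |B i| :=
    Finset.single_le_sum (fun i _ => abs_nonneg (B i)) (Finset.self_mem_range_succ L)
  have h2 := le_abs_self (B L)
  have h3 : (0 : ℝ) ≤ L := Nat.cast_nonneg L
  simp only [env]; linarith

theorem env_mono (B : ℕ → ℝ) {L L' : ℕ} (h : L ≤ L') : env B L ≤ env B L' := by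
  simp only [env]
  have h1 : ∑ i ∈ Finset.range (L + 1), |B i| ≤ ∑ i ∈ Finset.range (L' + 1), |B i| :=
    Finset.sum_le_sum_of_subset_of_nonneg (Finset.range_mono (by omega)) fun i _ _ => abs_nonneg (B i)
  have h2 : (L : ℝ) ≤ L' := by exact_mod_cast h
  linarith

/-- The ladder: `L_k = max {L ≤ 2^k : T(L) ≤ 2^k}` — the largest torus validated in step `k`. -/
def ladder (B : ℕ → ℝ) (k : ℕ) : ℕ := Nat.findGreatest (fun L => env B L ≤ (2 : ℝ) ^ k) (2 ^ k)

theorem le_ladder (B : ℕ → ℝ) {k L : ℕ} (h : env B L ≤ (2 : ℝ) ^ k) : L ≤ ladder B k := by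
  have h1 : (L : ℝ) ≤ (2 : ℝ) ^ k := (le_env B L).trans h
  have h2 : L ≤ 2 ^ k := by exact_mod_cast h1
  exact Nat.le_findGreatest (P := fun L => env B L ≤ (2 : ℝ) ^ k) h2 h

theorem env_ladder_le (B : ℕ → ℝ) {k : ℕ} (hk : ladder B k ≠ 0) : env B (ladder B k) ≤ (2 : ℝ) ^ k :=
  Nat.findGreatest_of_ne_zero (P := fun L => env B L ≤ (2 : ℝ) ^ k) rfl hk

/-- On a torus validated in step `k` the threshold is passed for every `β ≥ 2^k`. -/
theorem threshold_le (B : ℕ → ℝ) {k L : ℕ} (hL1 : 1 ≤ L) (hL : L ≤ ladder B k) {β : ℝ}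
    (hβ : (2 : ℝ) ^ k ≤ β) : B L ≤ β := by
  have hk : ladder B k ≠ 0 := by omega
  exact (self_le_env B L).trans (((env_mono B hL).trans (env_ladder_le B hk)).trans hβ)

/-! ### Generic step values `α_k = u_k (1 + t 2^{-k})`, `u_k = 1/(L_k + 1)` -/

/-- The step values `α_k = (1 + t 2^{-k}) / (L_k + 1)`. -/
def alphaEnc (B : ℕ → ℝ) (t : ℝ) (k : ℕ) : ℝ :=
  ((ladder B k : ℝ) + 1)⁻¹ * (1 + t * ((2 : ℝ) ^ k)⁻¹)

theorem alphaEnc_pos (B : ℕ → ℝ) {t : ℝ} (ht : 0 ≤ t) (k : ℕ) : 0 < alphaEnc B t k := by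
  unfold alphaEnc; positivity

theorem alphaEnc_le (B : ℕ → ℝ) {t : ℝ} (ht1 : t ≤ 1) (k : ℕ) :
    alphaEnc B t k ≤ 2 / ((ladder B k : ℝ) + 1) := by
  have hx : ((2 : ℝ) ^ k)⁻¹ ≤ 1 := inv_le_one_of_one_le₀ (one_le_pow₀ (by norm_num))
  have hx0 : (0 : ℝ) ≤ ((2 : ℝ) ^ k)⁻¹ := by positivity
  have h1 : 1 + t * ((2 : ℝ) ^ k)⁻¹ ≤ 2 := by nlinarith [mul_le_mul ht1 hx hx0 zero_le_one]
  have hpos : (0 : ℝ) < ((ladder B k : ℝ) + 1)⁻¹ := by positivity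
  calc alphaEnc B t k = ((ladder B k : ℝ) + 1)⁻¹ * (1 + t * ((2 : ℝ) ^ k)⁻¹) := rfl
    _ ≤ ((ladder B k : ℝ) + 1)⁻¹ * 2 := mul_le_mul_of_nonneg_left h1 hpos.le
    _ = 2 / ((ladder B k : ℝ) + 1) := by rw [mul_comm, div_eq_mul_inv]

/-- **Femto ⇒ validated**: `L · α_k ≤ 1` forces `L ≤ L_k` (because `α_k > 1/(L_k + 1)`). -/
theorem le_ladder_of_femto (B : ℕ → ℝ) {t : ℝ} (ht : 0 < t) {k L : ℕ}
    (hL : (L : ℝ) * alphaEnc B t k ≤ 1) : L ≤ ladder B k := by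
  by_contra hlt
  have hle : (ladder B k : ℝ) + 1 ≤ L := by
    exact_mod_cast Nat.lt_iff_add_one_le.1 (not_le.1 hlt)
  have hpos : (0 : ℝ) < (ladder B k : ℝ) + 1 := by positivity
  have hx : (0 : ℝ) < t * ((2 : ℝ) ^ k)⁻¹ := by positivity
  have h1 : (L : ℝ) * alphaEnc B t k = (L : ℝ) * (1 + t * ((2 : ℝ) ^ k)⁻¹) / ((ladder B k : ℝ) + 1) := by
    unfold alphaEnc; ring
  rw [h1, div_le_one hpos] at hL
  nlinarith


/-- **Genericity.** For positive `u_k` there is `t ∈ [1/2, 1]` such that the level sets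
`{√m · u_k (1 + t 2^{-k}) : m ≥ 1}` of distinct steps are disjoint: for `k ≠ k'` and fixed
`m, m'` the collision equation is affine in `t` with at most one root (two roots force
`2^{-k} = 2^{-k'}`), so the bad `t` form a countable, Lebesgue-null set. -/
theorem exists_generic (u : ℕ → ℝ) (hu : ∀ k, 0 < u k) :
    ∃ t : ℝ, 1 / 2 ≤ t ∧ t ≤ 1 ∧ ∀ (k k' m m' : ℕ), k ≠ k' → 1 ≤ m → 1 ≤ m' →
      Real.sqrt m * (u k * (1 + t * ((2 : ℝ) ^ k)⁻¹)) ≠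
        Real.sqrt m' * (u k' * (1 + t * ((2 : ℝ) ^ k')⁻¹)) := by
  classical
  let Bad : Set ℝ := ⋃ k : ℕ, ⋃ k' : ℕ, ⋃ m : ℕ, ⋃ m' : ℕ,
    {t : ℝ | k ≠ k' ∧ 1 ≤ m ∧ 1 ≤ m' ∧
      Real.sqrt m * (u k * (1 + t * ((2 : ℝ) ^ k)⁻¹)) =
        Real.sqrt m' * (u k' * (1 + t * ((2 : ℝ) ^ k')⁻¹))}
  have hsub : ∀ (k k' m m' : ℕ), Set.Subsingleton {t : ℝ | k ≠ k' ∧ 1 ≤ m ∧ 1 ≤ m' ∧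
      Real.sqrt m * (u k * (1 + t * ((2 : ℝ) ^ k)⁻¹)) =
        Real.sqrt m' * (u k' * (1 + t * ((2 : ℝ) ^ k')⁻¹))} := by
    intro k k' m m' t ht t' ht'
    obtain ⟨hkk, hm, -, hteq⟩ := ht
    obtain ⟨-, -, -, ht'eq⟩ := ht'
    have hP : 0 < Real.sqrt m * u k := mul_pos (Real.sqrt_pos.2 (by exact_mod_cast hm)) (hu k)
    have e1 : (Real.sqrt m * u k * ((2 : ℝ) ^ k)⁻¹ - Real.sqrt m' * u k' * ((2 : ℝ) ^ k')⁻¹) *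
        (t - t') = 0 := by
      linear_combination hteq - ht'eq
    rcases mul_eq_zero.1 e1 with hA | htt
    · exfalso
      have e2 : Real.sqrt m * u k = Real.sqrt m' * u k' := by
        linear_combination hteq - t * hA
      have e3 : Real.sqrt m * u k * ((2 : ℝ) ^ k)⁻¹ = Real.sqrt m * u k * ((2 : ℝ) ^ k')⁻¹ := by
        linear_combination hA - ((2 : ℝ) ^ k')⁻¹ * e2
      have e4 : ((2 : ℝ) ^ k)⁻¹ = ((2 : ℝ) ^ k')⁻¹ := mul_left_cancel₀ hP.ne' e3
      have e5 : (2 : ℝ) ^ k = (2 : ℝ) ^ k' := inv_injective e4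
      have e6 : (2 : ℕ) ^ k = 2 ^ k' := by exact_mod_cast e5
      exact hkk (Nat.pow_right_injective le_rfl e6)
    · exact sub_eq_zero.1 htt
  have hcount : Bad.Countable :=
    Set.countable_iUnion fun k => Set.countable_iUnion fun k' =>
      Set.countable_iUnion fun m => Set.countable_iUnion fun m' => (hsub k k' m m').countable
  have hB0 : volume Bad = 0 := hcount.measure_zero volume
  have hIcc : volume (Set.Icc (1 / 2 : ℝ) 1) ≠ 0 := by
    rw [Real.volume_Icc, Ne, ENNReal.ofReal_eq_zero]; norm_num
  have hns : ¬ Set.Icc (1 / 2 : ℝ) 1 ⊆ Bad := fun hs => hIcc (measure_mono_null hs hB0)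
  obtain ⟨t, htI, htB⟩ := Set.not_subset.1 hns
  refine ⟨t, htI.1, htI.2, fun k k' m m' hkk hm hm' heq => htB ?_⟩
  simp only [Bad, Set.mem_iUnion, Set.mem_setOf_eq]
  exact ⟨k, k', m, m', hkk, hm, hm', heq⟩

/-! ### The encoded shape `Γ` -/

open Classical in
/-- `Γ(√m · α_k) = 4^{-k}` on the level sets (`m ≥ 1`), `Γ = 1` elsewhere. -/
def gammaEnc (α : ℕ → ℝ) (s : ℝ) : ℝ :=
  if h : ∃ k m : ℕ, 1 ≤ m ∧ s = Real.sqrt m * α k then ((4 : ℝ) ^ (Classical.choose h))⁻¹ else 1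

theorem gammaEnc_pos (α : ℕ → ℝ) (s : ℝ) : 0 < gammaEnc α s := by
  unfold gammaEnc; split_ifs <;> positivity

theorem gammaEnc_le_one (α : ℕ → ℝ) (s : ℝ) : gammaEnc α s ≤ 1 := by
  unfold gammaEnc
  split_ifs
  · exact inv_le_one_of_one_le₀ (one_le_pow₀ (by norm_num))
  · exact le_rfl

theorem gammaEnc_eq {α : ℕ → ℝ}
    (hgen : ∀ (k k' m m' : ℕ), k ≠ k' → 1 ≤ m → 1 ≤ m' →
      Real.sqrt m * α k ≠ Real.sqrt m' * α k')
    (k m : ℕ) (hm : 1 ≤ m) : gammaEnc α (Real.sqrt m * α k) = ((4 : ℝ) ^ k)⁻¹ := by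
  have h : ∃ k' m' : ℕ, 1 ≤ m' ∧ Real.sqrt m * α k = Real.sqrt m' * α k' := ⟨k, m, hm, rfl⟩
  unfold gammaEnc
  rw [dif_pos h]
  obtain ⟨m', hm', heq⟩ := Classical.choose_spec h
  have hk : Classical.choose h = k := by
    by_contra hne
    exact hgen k (Classical.choose h) m m' (Ne.symm hne) hm hm' heq
  rw [hk]

/-! ### One step of arithmetic: `2^k ≤ β < 2^{k+1}` turns `[c, C]·β⁻²` into levels -/

theorem band_to_levels {β c C Y : ℝ} {k : ℕ} (h2k : (2 : ℝ) ^ k ≤ β) (hβlt : β < (2 : ℝ) ^ (k + 1))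
    (hc : 0 < c) (h_lo : c ≤ β ^ 2 * Y) (h_hi : β ^ 2 * Y ≤ C) :
    c / 4 * ((4 : ℝ) ^ k)⁻¹ ≤ Y ∧ Y ≤ |C| * ((4 : ℝ) ^ k)⁻¹ := by
  have h2kpos : 0 < (2 : ℝ) ^ k := by positivity
  have hβpos : 0 < β := h2kpos.trans_le h2k
  have hβ2 : 0 < β ^ 2 := by positivity
  have h4k : (4 : ℝ) ^ k = ((2 : ℝ) ^ k) ^ 2 := by
    rw [show (4 : ℝ) = 2 ^ 2 by norm_num, ← pow_mul, mul_comm, pow_mul]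
  have h4k1 : (4 : ℝ) ^ (k + 1) = ((2 : ℝ) ^ (k + 1)) ^ 2 := by
    rw [show (4 : ℝ) = 2 ^ 2 by norm_num, ← pow_mul, mul_comm, pow_mul]
  have hle : (4 : ℝ) ^ k ≤ β ^ 2 := by rw [h4k]; exact pow_le_pow_left₀ h2kpos.le h2k 2
  have hlt : β ^ 2 ≤ (4 : ℝ) ^ (k + 1) := by
    rw [h4k1]; exact (pow_lt_pow_left₀ hβlt hβpos.le two_ne_zero).le
  have h4pos : 0 < (4 : ℝ) ^ k := by positivity
  constructor
  · have hY : c / β ^ 2 ≤ Y := by rw [div_le_iff₀ hβ2]; linarith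
    have h1 : c / (4 : ℝ) ^ (k + 1) ≤ c / β ^ 2 := div_le_div_of_nonneg_left hc.le hβ2 hlt
    have h2 : c / 4 * ((4 : ℝ) ^ k)⁻¹ = c / (4 : ℝ) ^ (k + 1) := by rw [pow_succ]; field_simp
    rw [h2]; exact h1.trans hY
  · have hY : Y ≤ C / β ^ 2 := by rw [le_div_iff₀ hβ2]; linarith
    have h1 : C / β ^ 2 ≤ |C| / β ^ 2 := div_le_div_of_nonneg_right (le_abs_self C) hβ2.le
    have h2 : |C| / β ^ 2 ≤ |C| / (4 : ℝ) ^ k := div_le_div_of_nonneg_left (abs_nonneg C) h4pos hle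
    rw [← div_eq_mul_inv]
    exact hY.trans (h1.trans h2)

theorem allpairs_to_levels {β C Y : ℝ} {k : ℕ} (h2k : (2 : ℝ) ^ k ≤ β) (_hY : 0 ≤ Y)
    (h : β ^ 2 * Y ≤ C) : Y ≤ |C| * ((4 : ℝ) ^ k)⁻¹ := by
  have h2kpos : 0 < (2 : ℝ) ^ k := by positivity
  have hβpos : 0 < β := h2kpos.trans_le h2k
  have hβ2 : 0 < β ^ 2 := by positivity
  have h4k : (4 : ℝ) ^ k = ((2 : ℝ) ^ k) ^ 2 := by
    rw [show (4 : ℝ) = 2 ^ 2 by norm_num, ← pow_mul, mul_comm, pow_mul]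
  have hle : (4 : ℝ) ^ k ≤ β ^ 2 := by rw [h4k]; exact pow_le_pow_left₀ h2kpos.le h2k 2
  have h4pos : 0 < (4 : ℝ) ^ k := by positivity
  have h0 : Y ≤ C / β ^ 2 := by rw [le_div_iff₀ hβ2]; linarith
  have h1 : C / β ^ 2 ≤ |C| / β ^ 2 := div_le_div_of_nonneg_right (le_abs_self C) hβ2.le
  have h2 : |C| / β ^ 2 ≤ |C| / (4 : ℝ) ^ k := div_le_div_of_nonneg_left (abs_nonneg C) h4pos hle
  rw [← div_eq_mul_inv]
  exact h0.trans (h1.trans h2)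

/-! ### The transfer `C⁺ ⇒ crux` -/

/-- **Encoding at fixed data (the card's `crux_of_encoding`, PROVED).** From the fixed-torus
two-sided clauses at `(G, r)` with thresholds `B` and constants `0 < c`, `C`, the crux body at
`(G, r)`: `ℓ₀ = 1`, `β₀ = 1`, unit map `a(β) = α_{k(β)}`, `α_k = (1 + t 2^{-k})/(L_k + 1)` (`t`
generic, `L_k` the threshold ladder of `B`), shape `Γ(√m α_k) = 4^{-k}` (else `1`), constants
`c/4` and `|C|`. -/
theorem encoding_at {G : Type} [Group G] [TopologicalSpace G] [IsTopologicalGroup G] [CompactSpace G]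
    [MeasurableSpace G] [BorelSpace G] (r : LatticeRep G) {B : ℕ → ℝ} {c C : ℝ} (hc : 0 < c)
    (H : ∀ (L : ℕ) [NeZero L] (β : ℝ), B L ≤ β →
        let P : (Fin 4 → ZMod L) → Fin 4 → Fin 4 → GaugeConfig 4 L G → ℝ :=
          fun x i j U => (r.N : ℝ) - (r.ρ (plaquetteHolonomy U x i j)).trace.re
        let E : (GaugeConfig 4 L G → ℝ) → ℝ := fun F => wilsonExpectation (d := 4) (L := L) r.ρ β F
        let cov : (GaugeConfig 4 L G → ℝ) → (GaugeConfig 4 L G → ℝ) → ℝ :=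
          fun F F' => E (fun U => F U * F' U) - E F * E F'
        let dist : (Fin 4 → ZMod L) → (Fin 4 → ZMod L) → ℝ :=
          fun x y => Real.sqrt (∑ k : Fin 4, (((x k - y k).valMinAbs : ℤ) : ℝ) ^ 2)
        (∀ n : ℕ, 1 ≤ n → 8 * n ≤ L →
            c ≤ β ^ 2 * ((n : ℝ) ^ 8 * cov (P 0 0 1) (P (Pi.single (2 : Fin 4) ((n : ℕ) : ZMod L)) 0 1)) ∧
            β ^ 2 * ((n : ℝ) ^ 8 * cov (P 0 0 1) (P (Pi.single (2 : Fin 4) ((n : ℕ) : ZMod L)) 0 1)) ≤ C) ∧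
        (∀ (x y : Fin 4 → ZMod L) (i j i' j' : Fin 4), x ≠ y → i ≠ j → i' ≠ j' →
            β ^ 2 * (|cov (P x i j) (P y i' j')| * dist x y ^ 8) ≤ C)) :
    CruxAt r := by
  -- generic step values over the threshold ladder of `B`
  obtain ⟨t, ht1, ht2, hgen⟩ :=
    exists_generic (fun k => ((ladder B k : ℝ) + 1)⁻¹) (fun k => by positivity)
  have ht0 : 0 < t := by linarith
  have hgen' : ∀ (k k' m m' : ℕ), k ≠ k' → 1 ≤ m → 1 ≤ m' →
      Real.sqrt m * alphaEnc B t k ≠ Real.sqrt m' * alphaEnc B t k' := hgen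
  refine ⟨fun β => alphaEnc B t (stepIdx β), gammaEnc (alphaEnc B t), 1, 1, c / 4, |C|, one_pos,
    by positivity, fun β => alphaEnc_pos B ht0.le _, ?_,
    fun s _ _ => ⟨gammaEnc_pos _ s, gammaEnc_le_one _ s⟩, ?_⟩
  · -- `a → 0`: the ladder is unbounded
    refine Metric.tendsto_atTop.2 fun ε hε => ?_
    obtain ⟨L₀, hL₀⟩ := exists_nat_one_div_lt (half_pos hε)
    obtain ⟨K, hK⟩ := pow_unbounded_of_one_lt (env B L₀) (by norm_num : (1 : ℝ) < 2)
    refine ⟨(2 : ℝ) ^ K, fun β hβ => ?_⟩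
    have hk : K ≤ stepIdx β := le_stepIdx_of_le hβ
    have henv : env B L₀ ≤ (2 : ℝ) ^ stepIdx β :=
      hK.le.trans (pow_le_pow_right₀ (by norm_num) hk)
    have hL : L₀ ≤ ladder B (stepIdx β) := le_ladder B henv
    have hL' : (L₀ : ℝ) + 1 ≤ (ladder B (stepIdx β) : ℝ) + 1 := by
      exact_mod_cast Nat.succ_le_succ hL
    rw [Real.dist_eq, sub_zero, abs_of_pos (alphaEnc_pos B ht0.le _)]
    calc alphaEnc B t (stepIdx β) ≤ 2 / ((ladder B (stepIdx β) : ℝ) + 1) := alphaEnc_le B ht2 _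
      _ ≤ 2 / ((L₀ : ℝ) + 1) := div_le_div_of_nonneg_left (by norm_num) (by positivity) hL'
      _ = 2 * (1 / ((L₀ : ℝ) + 1)) := by ring
      _ < 2 * (ε / 2) := by gcongr
      _ = ε := by ring
  · -- the clauses on a femto torus in step `k`
    intro L _ β hβ hLa
    have hβ1 : 1 ≤ β := hβ
    have h2k : (2 : ℝ) ^ stepIdx β ≤ β := two_pow_stepIdx_le hβ1
    have hβlt : β < (2 : ℝ) ^ (stepIdx β + 1) := lt_two_pow_stepIdx_succ β
    have hL1 : 1 ≤ L := Nat.one_le_iff_ne_zero.2 (NeZero.ne L)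
    have hLa' : (L : ℝ) * alphaEnc B t (stepIdx β) ≤ 1 := hLa
    have hLk : L ≤ ladder B (stepIdx β) := le_ladder_of_femto B ht0 hLa'
    have hBL : B L ≤ β := threshold_le B hL1 hLk h2k
    have HH := H L β hBL
    obtain ⟨hax, hall⟩ := HH
    refine ⟨fun n hn h8 => ?_, fun x y i j i' j' hxy hij hij' => ?_⟩
    · obtain ⟨h_lo, h_hi⟩ := hax n hn h8
      have hΓ : gammaEnc (alphaEnc B t) ((n : ℝ) * alphaEnc B t (stepIdx β)) =
          ((4 : ℝ) ^ stepIdx β)⁻¹ := by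
        have e : (n : ℝ) * alphaEnc B t (stepIdx β) =
            Real.sqrt ((n ^ 2 : ℕ) : ℝ) * alphaEnc B t (stepIdx β) := by
          congr 1
          push_cast
          rw [Real.sqrt_sq (Nat.cast_nonneg n)]
        rw [e]
        exact gammaEnc_eq hgen' (stepIdx β) (n ^ 2) (by nlinarith)
      rw [hΓ]
      exact band_to_levels h2k hβlt hc h_lo h_hi
    · have hxy' := hall x y i j i' j' hxy hij hij'
      obtain ⟨m, hm, hdist⟩ := dist_eq_sqrt_nat x y hxy
      dsimp only at hxy' ⊢
      rw [hdist] at hxy' ⊢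
      have hΓ : gammaEnc (alphaEnc B t) (Real.sqrt (m : ℝ) * alphaEnc B t (stepIdx β)) =
          ((4 : ℝ) ^ stepIdx β)⁻¹ :=
        gammaEnc_eq hgen' (stepIdx β) m hm
      rw [hΓ]
      exact allpairs_to_levels h2k (by positivity) hxy'

/-! ## § Composition -/

/-- `K2⁻ ∧ K2⁺ ⇒` the crux body at every `(G, r)` (unbundled form, so that
`FemtoCurvatureTwoPoint_of` stays the file's unique crux-concluding theorem). -/
theorem cruxAt_of_bounds (hA : AxisLowerFixedTorus) (hU : PairUpperFixedTorus) :
    ∀ (G : Type) [Group G] [TopologicalSpace G] [IsTopologicalGroup G] [CompactSpace G],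
      IsCompactSimpleLieGroup G →
        letI : MeasurableSpace G := borel G
        haveI : BorelSpace G := ⟨rfl⟩
        ∀ r : LatticeRep G, CruxAt r := by
  intro G _ _ _ _ hG r
  letI : MeasurableSpace G := borel G
  haveI : BorelSpace G := ⟨rfl⟩
  obtain ⟨B, c, C, hc, H⟩ := fixedTorusTwoSided_of hA hU G hG r
  exact encoding_at r hc H

/-- **Glue DU₂ ⇒ DU (proved; hypercubic symmetry).** The two-profile bounds give the 24-family bounds
via `Theorems.FemtoCurvatureTwoPoint.diagFamilies_two_profiles` (transverse families = the axis
profile, longitudinal families = the `e₀` profile; the variance clause is the case `s = 0`). -/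
theorem diagUpper_of_twoProfiles (h : DiagUpperTwoProfiles) : DiagUpperFixedTorus := by
  intro G _ _ _ _ _ _ hG r
  obtain ⟨B, C, hB⟩ := h G hG r
  refine ⟨B, C, fun L _ β hβ P E hP hE => ?_⟩
  obtain ⟨hVar, hST⟩ := hB L β hβ P E hP hE
  have two := Summit.QuantumFields.YangMills.Theorems.FemtoCurvatureTwoPoint.diagFamilies_two_profiles
    G r.N r.ρ r.continuous L β P E hP hE
  constructor
  · intro i j hij
    obtain ⟨k, hki, hkj⟩ := (show ∀ a b : Fin 4, ∃ k : Fin 4, k ≠ a ∧ k ≠ b by decide) i j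
    have h0 := (two i j k 0 hij).1 ⟨hki, hkj⟩
    simp only [Nat.cast_zero, Pi.single_zero] at h0
    rw [h0]
    exact hVar
  · intro i j μ s hij hs hsL
    by_cases hμ : μ ≠ i ∧ μ ≠ j
    · rw [(two i j μ s hij).1 hμ]
      exact (hST s hs hsL).1
    · have hμ' : μ = i ∨ μ = j := by tauto
      rw [(two i j μ s hij).2 hμ']
      exact (hST s hs hsL).2

/-- **Composition (kernel-checked; the ONLY theorem of this file concluding the crux by name).** The
registered stubs imply the crux: `axisLower_of stub_maxwellKernelBand axisGaussianLower_of_stubs :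
AxisLowerFixedTorus` and (reshape c1) `pairUpper_of' stub_offAxisDomination
(diagUpper_of_twoProfiles diagUpperTwoProfiles_of_stubs) : PairUpperFixedTorus` give C⁺ (`fixedTorusTwoSided_of`),
and the proved generic-step encoding (`encoding_at`) gives `LangevinControlUV.FemtoCurvatureTwoPoint`.
Sorry-free as soon as GD⁻ and DU₂ are (OA, K1a, the family reduction and all glue are proved). -/
theorem FemtoCurvatureTwoPoint_of :
    Summit.QuantumFields.YangMills.Theses.LangevinControlUV.FemtoCurvatureTwoPoint :=
  fun G _ _ _ _ hG r =>
    cruxAt_of_bounds (axisLower_of stub_maxwellKernelBand axisGaussianLower_of_stubs)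
      (pairUpper_of' stub_offAxisDomination
        (diagUpper_of_twoProfiles diagUpperTwoProfiles_of_stubs)) G hG r

/-- **The ONE missing theory (lead c1, for the planner's promote-stub).** Toron-aware second-order
Laplace asymptotics of Wilson's measure on the FIXED torus, covariance level, constants uniform in `L`,
thresholds free: the conjunction of the two open stubs GD⁻ (`AxisGaussianLower`) and DU₂
(`DiagUpperTwoProfiles`). -/
def FixedTorusDiagonalSemiclassics : Prop := AxisGaussianLower ∧ DiagUpperTwoProfiles

/-- **crux ⇐ `FixedTorusDiagonalSemiclassics`** given off-axis domination (OA, proved by the lead) — in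
the unbundled form `∀ G r, CruxAt r` (so that `FemtoCurvatureTwoPoint_of` stays the unique theorem
concluding the crux by name); everything else it uses is proved: K1a (`stub_maxwellKernelBand`,
landed), `axisLower_of`, `pairUpper_of'`, `diagUpper_of_twoProfiles` (landed family reduction),
`cruxAt_of_bounds` (encoding). -/
theorem cruxAt_of_semiclassics (h : FixedTorusDiagonalSemiclassics) (hOA : OffAxisDomination) :
    ∀ (G : Type) [Group G] [TopologicalSpace G] [IsTopologicalGroup G] [CompactSpace G],
      IsCompactSimpleLieGroup G →
        letI : MeasurableSpace G := borel G
        haveI : BorelSpace G := ⟨rfl⟩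
        ∀ r : LatticeRep G, CruxAt r :=
  fun G _ _ _ _ hG r =>
    cruxAt_of_bounds (axisLower_of stub_maxwellKernelBand h.1)
      (pairUpper_of' hOA (diagUpper_of_twoProfiles h.2)) G hG r

/-! ## § Alternative entry point (lead c1): per-torus LIMITS with `L`-uniform bounds on the limit values -/

/-- The axis kernel `K_L(ne₂)`: half the sum of the (negative) second differences of the torus Green's
function in the two plaquette directions `e₀, e₁`, evaluated at `n e₂` (the kernel of GD⁻ / K1a). -/
def axisKernel (L n : ℕ) [NeZero L] : ℝ :=
  ((2 * Literature.Probability.LatticeModels.torusGreen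
        (Pi.single (2 : Fin 4) ((n : ℕ) : ZMod L) : Fin 4 → ZMod L)
      - Literature.Probability.LatticeModels.torusGreen
        ((Pi.single (2 : Fin 4) ((n : ℕ) : ZMod L) : Fin 4 → ZMod L)
          + Pi.single (0 : Fin 4) (1 : ZMod L))
      - Literature.Probability.LatticeModels.torusGreen
        ((Pi.single (2 : Fin 4) ((n : ℕ) : ZMod L) : Fin 4 → ZMod L)
          - Pi.single (0 : Fin 4) (1 : ZMod L)))
    + (2 * Literature.Probability.LatticeModels.torusGreen
        (Pi.single (2 : Fin 4) ((n : ℕ) : ZMod L) : Fin 4 → ZMod L)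
      - Literature.Probability.LatticeModels.torusGreen
        ((Pi.single (2 : Fin 4) ((n : ℕ) : ZMod L) : Fin 4 → ZMod L)
          + Pi.single (1 : Fin 4) (1 : ZMod L))
      - Literature.Probability.LatticeModels.torusGreen
        ((Pi.single (2 : Fin 4) ((n : ℕ) : ZMod L) : Fin 4 → ZMod L)
          - Pi.single (1 : Fin 4) (1 : ZMod L)))) / 2

/-- The scaled diagonal plaquette covariance `β ↦ β² · Cov_{L,β}(P_0^{01}, P_x^{01})`,
`P = N − Re tr r(U_p)`, as a function of the coupling (for limits `β → ∞` at fixed `L`). -/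
def scaledCov {G : Type} [Group G] [TopologicalSpace G] [IsTopologicalGroup G] [CompactSpace G]
    [MeasurableSpace G] [BorelSpace G] (r : LatticeRep G) (L : ℕ) [NeZero L]
    (x : Fin 4 → ZMod L) (β : ℝ) : ℝ :=
  β ^ 2 *
    (wilsonExpectation r.ρ β (fun U : GaugeConfig 4 L G =>
        ((r.N : ℝ) - (r.ρ (plaquetteHolonomy U 0 0 1)).trace.re) *
          ((r.N : ℝ) - (r.ρ (plaquetteHolonomy U x 0 1)).trace.re))
      - wilsonExpectation r.ρ β (fun U : GaugeConfig 4 L G =>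
          (r.N : ℝ) - (r.ρ (plaquetteHolonomy U 0 0 1)).trace.re)
        * wilsonExpectation r.ρ β (fun U : GaugeConfig 4 L G =>
          (r.N : ℝ) - (r.ρ (plaquetteHolonomy U x 0 1)).trace.re))

/-- **Per-torus semiclassical LIMITS (the natural output of a fixed-`L` Laplace expansion) with
`L`-uniform bounds on the LIMIT VALUES.** For every compact simple `G` and faithful unitary `r` there
are `κ₀ > 0` and `C₀` such that on every torus `(ℤ/L)⁴` the limits
`ℓ_L(x) = lim_{β→∞} β² Cov_{L,β}(P_0^{01}, P_x^{01})` EXIST for all `x` and satisfy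
`κ₀ K_L(ne₂)² ≤ ℓ_L(ne₂)` (`8n ≤ L`), `|ℓ_L(0)| ≤ C₀`, and
`|ℓ_L(s e₂)|, |ℓ_L(s e₀)| ≤ C₀ / min(s, L−s)⁸` (`1 ≤ s ≤ L−1`). No rate and no uniformity of the
expansion in `L` is asked — only uniform bounds on the limiting (toron-averaged Gaussian) values.
This implies both open stubs (`semiclassics_of_limits`, proved below, thresholds extracted from the
limits torus by torus); it is offered to the planner as an equivalent-in-practice target. -/
def SemiclassicalLimits : Prop :=
  ∀ (G : Type) [Group G] [TopologicalSpace G] [IsTopologicalGroup G] [CompactSpace G]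
      [MeasurableSpace G] [BorelSpace G], IsCompactSimpleLieGroup G →
    ∀ (r : LatticeRep G), ∃ κ₀ : ℝ, 0 < κ₀ ∧ ∃ C₀ : ℝ, ∀ (L : ℕ) [NeZero L],
      ∃ ℓ : (Fin 4 → ZMod L) → ℝ,
        (∀ x : Fin 4 → ZMod L,
            Filter.Tendsto (scaledCov r L x) Filter.atTop (nhds (ℓ x))) ∧
        (∀ n : ℕ, 1 ≤ n → 8 * n ≤ L →
            κ₀ * axisKernel L n ^ 2 ≤ ℓ (Pi.single (2 : Fin 4) ((n : ℕ) : ZMod L))) ∧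
        |ℓ 0| ≤ C₀ ∧
        (∀ s : ℕ, 1 ≤ s → s + 1 ≤ L →
            |ℓ (Pi.single (2 : Fin 4) ((s : ℕ) : ZMod L))| * (min (s : ℝ) ((L : ℝ) - s)) ^ 8 ≤ C₀ ∧
            |ℓ (Pi.single (0 : Fin 4) ((s : ℕ) : ZMod L))| * (min (s : ℝ) ((L : ℝ) - s)) ^ 8 ≤ C₀)

/-- **Limits ⇒ GD⁻** (with `κ = κ₀/2`; the axis kernel is `> 0` by K1a, so the strict margin
`κ₀K²/2` turns the limit inequality into an eventual one; finitely many `n` per torus give one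
threshold `B(L)`). -/
theorem axisGaussianLower_of_limits (hK : MaxwellKernelBand) (h : SemiclassicalLimits) :
    AxisGaussianLower := by
  intro G _ _ _ _ _ _ hG r
  obtain ⟨κ₀, hκ₀, C₀, hLim⟩ := h G hG r
  obtain ⟨c₁, C₁, hc₁, hband⟩ := hK
  refine ⟨κ₀ / 2, by positivity, fun L _ => ?_⟩
  obtain ⟨ℓ, hT, hlow, -, -⟩ := hLim L
  have hev : ∀ n ∈ Finset.range (L + 1), ∀ᶠ β : ℝ in Filter.atTop,
      1 ≤ n → 8 * n ≤ L →
        κ₀ / 2 * axisKernel L n ^ 2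
          ≤ scaledCov r L (Pi.single (2 : Fin 4) ((n : ℕ) : ZMod L)) β := by
    intro n _
    by_cases hn : 1 ≤ n ∧ 8 * n ≤ L
    · obtain ⟨hn1, hn8⟩ := hn
      have hb := (hband L (Pi.single (0 : Fin 4) (1 : ZMod L)) (Pi.single (1 : Fin 4) (1 : ZMod L)) _
        rfl rfl rfl n hn1 hn8).1
      change c₁ ≤ (n : ℝ) ^ 4 * axisKernel L n at hb
      have hKpos : 0 < axisKernel L n := by
        by_contra hle
        push Not at hle
        have : (n : ℝ) ^ 4 * axisKernel L n ≤ 0 :=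
          mul_nonpos_of_nonneg_of_nonpos (by positivity) hle
        linarith
      have hlt : κ₀ / 2 * axisKernel L n ^ 2 < ℓ (Pi.single (2 : Fin 4) ((n : ℕ) : ZMod L)) := by
        have h1 := hlow n hn1 hn8
        have h2 : 0 < κ₀ / 2 * axisKernel L n ^ 2 := by positivity
        linarith
      exact ((hT _).eventually (eventually_gt_nhds hlt)).mono fun β hβ _ _ => hβ.le
    · exact Filter.Eventually.of_forall fun β h1 h8 => absurd ⟨h1, h8⟩ hn
  obtain ⟨B, hB⟩ := Filter.eventually_atTop.1 ((Filter.eventually_all_finset _).2 hev)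
  refine ⟨B, fun β hβ n hn h8 => ?_⟩
  have hmem : n ∈ Finset.range (L + 1) := by
    rw [Finset.mem_range]; omega
  have := hB β hβ n hmem hn h8
  simpa only [scaledCov, axisKernel] using this

/-- **Limits ⇒ DU₂** (with `C = C₀ + 1`; margin `1` for the variance clause and `1 / min(s,L−s)⁸`
for the weighted clauses; finitely many `s` per torus give one threshold `B(L)`). -/
theorem diagUpperTwoProfiles_of_limits (h : SemiclassicalLimits) : DiagUpperTwoProfiles := by
  intro G _ _ _ _ _ _ hG r
  obtain ⟨κ₀, -, C₀, hLim⟩ := h G hG r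
  classical
  have hB : ∀ L : ℕ, ∃ B : ℝ, ∀ (hL0 : L ≠ 0) (β : ℝ), B ≤ β →
      haveI : NeZero L := ⟨hL0⟩
      |scaledCov r L 0 β| ≤ C₀ + 1 ∧
      ∀ s : ℕ, 1 ≤ s → s + 1 ≤ L →
        |scaledCov r L (Pi.single (2 : Fin 4) ((s : ℕ) : ZMod L)) β|
            * (min (s : ℝ) ((L : ℝ) - s)) ^ 8 ≤ C₀ + 1 ∧
        |scaledCov r L (Pi.single (0 : Fin 4) ((s : ℕ) : ZMod L)) β|
            * (min (s : ℝ) ((L : ℝ) - s)) ^ 8 ≤ C₀ + 1 := by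
    intro L
    by_cases hL0 : L = 0
    · exact ⟨0, fun h => absurd hL0 h⟩
    haveI : NeZero L := ⟨hL0⟩
    obtain ⟨ℓ, hT, -, h0, hs⟩ := hLim L
    -- from `dist (f β) ℓ < ε` to the weighted bound
    have key : ∀ (x : Fin 4 → ZMod L) (w : ℝ), 0 < w → |ℓ x| * w ≤ C₀ →
        ∀ᶠ β : ℝ in Filter.atTop, |scaledCov r L x β| * w ≤ C₀ + 1 := by
      intro x w hw hℓ
      have hev := Metric.tendsto_nhds.1 (hT x) (1 / w) (by positivity)
      refine hev.mono fun β hβ => ?_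
      rw [Real.dist_eq] at hβ
      have h1 : |scaledCov r L x β| ≤ |ℓ x| + |scaledCov r L x β - ℓ x| := by
        have := abs_add_le (ℓ x) (scaledCov r L x β - ℓ x)
        rwa [add_sub_cancel] at this
      have h2 : |scaledCov r L x β - ℓ x| * w ≤ 1 := by
        have := mul_le_mul_of_nonneg_right hβ.le hw.le
        rwa [one_div, inv_mul_cancel₀ hw.ne'] at this
      nlinarith [mul_le_mul_of_nonneg_right h1 hw.le]
    have ev0 : ∀ᶠ β : ℝ in Filter.atTop, |scaledCov r L 0 β| ≤ C₀ + 1 := by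
      have := key 0 1 one_pos (by simpa using h0)
      simpa using this
    have evs : ∀ s ∈ Finset.range (L + 1), ∀ᶠ β : ℝ in Filter.atTop, 1 ≤ s → s + 1 ≤ L →
        |scaledCov r L (Pi.single (2 : Fin 4) ((s : ℕ) : ZMod L)) β|
            * (min (s : ℝ) ((L : ℝ) - s)) ^ 8 ≤ C₀ + 1 ∧
        |scaledCov r L (Pi.single (0 : Fin 4) ((s : ℕ) : ZMod L)) β|
            * (min (s : ℝ) ((L : ℝ) - s)) ^ 8 ≤ C₀ + 1 := by
      intro s _
      by_cases hsd : 1 ≤ s ∧ s + 1 ≤ L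
      · obtain ⟨hs1, hsL⟩ := hsd
        have hw : 0 < (min (s : ℝ) ((L : ℝ) - s)) ^ 8 := by
          apply pow_pos
          apply lt_min
          · exact_mod_cast hs1
          · have : (s : ℝ) + 1 ≤ (L : ℝ) := by exact_mod_cast hsL
            linarith
        obtain ⟨hs2, hs0⟩ := hs s hs1 hsL
        exact ((key _ _ hw hs2).and (key _ _ hw hs0)).mono fun β hβ _ _ => hβ
      · exact Filter.Eventually.of_forall fun β h1 h2 => absurd ⟨h1, h2⟩ hsd
    obtain ⟨B, hB⟩ := Filter.eventually_atTop.1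
      (ev0.and ((Filter.eventually_all_finset _).2 evs))
    refine ⟨B, fun _ β hβ => ⟨(hB β hβ).1, fun s hs1 hsL => ?_⟩⟩
    have hmem : s ∈ Finset.range (L + 1) := by
      rw [Finset.mem_range]; omega
    exact (hB β hβ).2 s hmem hs1 hsL
  choose B hB using hB
  refine ⟨B, C₀ + 1, fun L _ β hβ P E hP hE => ?_⟩
  subst hP hE
  obtain ⟨h0', hs'⟩ := hB L (NeZero.ne L) β hβ
  refine ⟨?_, fun s hs1 hsL => ?_⟩
  · have h := h0'
    simp only [scaledCov, abs_mul, abs_pow, sq_abs] at h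
    simpa only using h
  · obtain ⟨h2, h0⟩ := hs' s hs1 hsL
    simp only [scaledCov, abs_mul, abs_pow, sq_abs, mul_assoc] at h2 h0
    exact ⟨by simpa only [mul_assoc] using h2, by simpa only [mul_assoc] using h0⟩

/-- **Limits ⇒ the missing theory** (`FixedTorusDiagonalSemiclassics`), with K1a for the positivity of
the axis kernel. -/
theorem semiclassics_of_limits (hK : MaxwellKernelBand) (h : SemiclassicalLimits) :
    FixedTorusDiagonalSemiclassics :=
  ⟨axisGaussianLower_of_limits hK h, diagUpperTwoProfiles_of_limits h⟩

/-- **Transfer `C⁺ ⇒ crux` (the card's `crux_of_encoding`, PROVED)**, concluded in the unbundled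
form `∀ G r, CruxAt r` so that `FemtoCurvatureTwoPoint_of` stays the file's unique crux-concluding
theorem; `femtoCurvatureTwoPoint_iff_cruxAt.2 (encoding h)` is the crux itself. -/
theorem encoding (hC : FixedTorusTwoSided) :
    ∀ (G : Type) [Group G] [TopologicalSpace G] [IsTopologicalGroup G] [CompactSpace G],
      IsCompactSimpleLieGroup G →
        letI : MeasurableSpace G := borel G
        haveI : BorelSpace G := ⟨rfl⟩
        ∀ r : LatticeRep G, CruxAt r := by
  intro G _ _ _ _ hG r
  letI : MeasurableSpace G := borel G
  haveI : BorelSpace G := ⟨rfl⟩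
  obtain ⟨B, c, C, hc, H⟩ := hC G hG r
  exact encoding_at r hc H

/-! ## § Nesting with line `deep-band-gaussian-regime` (TRIAGE r1-3, sharpen (3))

`DeepBandTwoPoint` below is a VERBATIM copy of `Ideator2.DeepBandTwoPoint`
(`Cruxes/FemtoCurvatureTwoPoint/SketchIdeator2.lean`); it implies this line's C⁺ with thresholds
`B(L) := max β₀ (M log L)`, so the two encoding lines are two rungs (per-torus limit /
`L`-uniform band) over ONE transfer `encoding`. -/

/-- Verbatim copy of `Ideator2.DeepBandTwoPoint` (C⁺ of card `deep-band-gaussian-regime`). -/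
def DeepBandTwoPoint : Prop :=
  ∀ (G : Type) [Group G] [TopologicalSpace G] [IsTopologicalGroup G] [CompactSpace G],
    IsCompactSimpleLieGroup G →
    letI : MeasurableSpace G := borel G
    haveI : BorelSpace G := ⟨rfl⟩
    ∀ (r : LatticeRep G), ∃ (M β₀ c C : ℝ), 0 < M ∧ 0 < c ∧
      ∀ (L : ℕ) [NeZero L] (β : ℝ), β₀ ≤ β → Real.log (L : ℝ) ≤ β / M →
        let P : (Fin 4 → ZMod L) → Fin 4 → Fin 4 → GaugeConfig 4 L G → ℝ :=
          fun x i j U => (r.N : ℝ) - (r.ρ (plaquetteHolonomy U x i j)).trace.re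
        let E : (GaugeConfig 4 L G → ℝ) → ℝ := fun F => wilsonExpectation (d := 4) (L := L) r.ρ β F
        let cov : (GaugeConfig 4 L G → ℝ) → (GaugeConfig 4 L G → ℝ) → ℝ :=
          fun F F' => E (fun U => F U * F' U) - E F * E F'
        let dist : (Fin 4 → ZMod L) → (Fin 4 → ZMod L) → ℝ :=
          fun x y => Real.sqrt (∑ k : Fin 4, (((x k - y k).valMinAbs : ℤ) : ℝ) ^ 2)
        (∀ n : ℕ, 1 ≤ n → 8 * n ≤ L →
            c ≤ β ^ 2 * ((n : ℝ) ^ 8 * cov (P 0 0 1) (P (Pi.single (2 : Fin 4) ((n : ℕ) : ZMod L)) 0 1)) ∧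
            β ^ 2 * ((n : ℝ) ^ 8 * cov (P 0 0 1) (P (Pi.single (2 : Fin 4) ((n : ℕ) : ZMod L)) 0 1)) ≤ C) ∧
        (∀ (x y : Fin 4 → ZMod L) (i j i' j' : Fin 4), x ≠ y → i ≠ j → i' ≠ j' →
            β ^ 2 * (|cov (P x i j) (P y i' j')| * dist x y ^ 8) ≤ C)

/-- The deep band is a uniform threshold: `DeepBandTwoPoint ⇒ FixedTorusTwoSided` with
`B(L) = max β₀ (M · log L)`. -/
theorem fixedTorusTwoSided_of_deepBand : DeepBandTwoPoint → FixedTorusTwoSided := by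
  intro hD G _ _ _ _ hG r
  obtain ⟨M, β₀, c, C, hM, hc, H⟩ := hD G hG r
  refine ⟨fun L => max β₀ (M * Real.log (L : ℝ)), c, C, hc, ?_⟩
  intro L _ β hβ
  have hβ' : max β₀ (M * Real.log (L : ℝ)) ≤ β := hβ
  have h1 : β₀ ≤ β := (le_max_left _ _).trans hβ'
  have h2 : Real.log (L : ℝ) ≤ β / M := by
    rw [le_div_iff₀ hM, mul_comm]
    exact (le_max_right _ _).trans hβ'
  exact H L β h1 h2

/-- Hence the deep-band engine also closes the crux through THIS file's transfer (unbundled form;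
`femtoCurvatureTwoPoint_iff_cruxAt.2 (cruxAt_of_deepBand h)` is the crux). -/
theorem cruxAt_of_deepBand (h : DeepBandTwoPoint) :
    ∀ (G : Type) [Group G] [TopologicalSpace G] [IsTopologicalGroup G] [CompactSpace G],
      IsCompactSimpleLieGroup G →
        letI : MeasurableSpace G := borel G
        haveI : BorelSpace G := ⟨rfl⟩
        ∀ r : LatticeRep G, CruxAt r :=
  encoding (fixedTorusTwoSided_of_deepBand h)

end Summit.QuantumFields.YangMills.Cruxes.FemtoCurvatureTwoPoint.GenericStepGammaEncoding

end
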